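import Summits.FinalStateConjecture.FinalStateConjecture.Theorems.BartnikGapSettlingGapExhaustionPhotonShellNodeDefs
import Summits.FinalStateConjecture.FinalStateConjecture.Theorems.BartnikGapSettlingGapExhaustionNodeChartPackage
import Summits.FinalStateConjecture.FinalStateConjecture.Theorems.BartnikGapSettlingGapExhaustionOutwardSweepOfIK
import Summits.FinalStateConjecture.FinalStateConjecture.Theorems.BartnikGapSettlingGapExhaustionInwardSweepOfIK
import Summits.FinalStateConjecture.FinalStateConjecture.Theorems.BartnikGapSettlingGapExhaustionConditionalExtensionFar
import Summits.FinalStateConjecture.FinalStateConjecture.Theorems.BartnikGapSettlingGapExhaustionDocOfSandwich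
import Summits.FinalStateConjecture.FinalStateConjecture.Theorems.BartnikGapSettlingGapExhaustionConditionalExtensionFarSilent
import Summits.FinalStateConjecture.FinalStateConjecture.Theorems.BartnikGapSettlingGapExhaustionFarChartExtension
import Summits.FinalStateConjecture.FinalStateConjecture.Theorems.BartnikGapSettlingGapExhaustionOpenSubsetChronologicalPast
import Literature.Geometry.Lorentzian.RedShiftedHorizon
import Literature.Geometry.Lorentzian.KillingHorizonShadowAlong
import Literature.Geometry.Lorentzian.KerrPhotonShellTurningPoints
import Literature.Geometry.Lorentzian.NearKerrLeaf
import Literature.Geometry.Lorentzian.BoundedGeometry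
import Literature.Geometry.Lorentzian.KerrRadiusPseudoconvexityKS
import Literature.Geometry.Lorentzian.KerrRadiusConditionalPseudoconvexity
import Summits.FinalStateConjecture.FinalStateConjecture.Theorems.BartnikGapSettlingGapExhaustionHessMarginStable
import Summits.FinalStateConjecture.FinalStateConjecture.Theorems.BartnikGapSettlingGapExhaustionCylindersBendInwardOf
import Summits.FinalStateConjecture.FinalStateConjecture.Theorems.BartnikGapSettlingGapExhaustionCylindersExactMargin
import Summits.FinalStateConjecture.FinalStateConjecture.Theorems.BartnikGapSettlingGapExhaustionZeroEnergyExactMargin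
import Summits.FinalStateConjecture.FinalStateConjecture.Theorems.BartnikGapSettlingGapExhaustionHessMarginStableLin
import Summits.FinalStateConjecture.FinalStateConjecture.Theorems.BartnikGapSettlingGapExhaustionZeroEnergyBendInwardOf
import Summits.FinalStateConjecture.FinalStateConjecture.Theorems.BartnikGapSettlingGapExhaustionCylindersBendOutwardOf
import Summits.FinalStateConjecture.FinalStateConjecture.Theorems.BartnikGapSettlingGapExhaustionMultiplierFormStable
import Summits.FinalStateConjecture.FinalStateConjecture.Theorems.BartnikGapSettlingGapExhaustionConditionalMultiplierOf
import Summits.FinalStateConjecture.FinalStateConjecture.Theorems.BartnikGapSettlingGapExhaustionRadiusNoncharacteristic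
import Summits.FinalStateConjecture.FinalStateConjecture.Theorems.BartnikGapSettlingGapExhaustionNoncharStable
import Summits.FinalStateConjecture.FinalStateConjecture.Theorems.BartnikGapSettlingGapExhaustionNoncharacteristicOf
import Summits.FinalStateConjecture.FinalStateConjecture.Theorems.BartnikGapSettlingGapExhaustionKillingHessianSkew
import Summits.FinalStateConjecture.FinalStateConjecture.Theorems.BartnikGapSettlingGapExhaustionKillingHessianAlt
import Summits.FinalStateConjecture.FinalStateConjecture.Theorems.BartnikGapSettlingGapExhaustionCurvatureLikeAlgebra
import Summits.FinalStateConjecture.FinalStateConjecture.Theorems.BartnikGapSettlingGapExhaustionKillingProlongationOf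
import Summits.FinalStateConjecture.FinalStateConjecture.Theorems.BartnikGapSettlingGapExhaustionFirstOrderVanishing
import Summits.FinalStateConjecture.FinalStateConjecture.Theorems.BartnikGapSettlingGapExhaustionKillingJetBound
import Summits.FinalStateConjecture.FinalStateConjecture.Theorems.BartnikGapSettlingGapExhaustionKillingUniqueContinuation
import Summits.FinalStateConjecture.FinalStateConjecture.Theorems.BartnikGapSettlingGapExhaustionKillingPatching
import Summits.FinalStateConjecture.FinalStateConjecture.Theorems.BartnikGapSettlingGapExhaustionMultiplierBelowShell
import Summits.FinalStateConjecture.FinalStateConjecture.Theorems.BartnikGapSettlingGapExhaustionMultiplierBeyondShell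
import Summits.FinalStateConjecture.FinalStateConjecture.Theorems.BartnikGapSettlingGapExhaustionIsKillingFieldOnPatching
import Summits.FinalStateConjecture.FinalStateConjecture.Theorems.BartnikGapSettlingGapExhaustionLevelSweep
import Summits.FinalStateConjecture.FinalStateConjecture.Theorems.BartnikGapSettlingGapExhaustionKerrRadiusSublevelConvex
import Summits.FinalStateConjecture.FinalStateConjecture.Theorems.BartnikGapSettlingGapExhaustionKerrRadiusBandCover
import Summits.FinalStateConjecture.FinalStateConjecture.Theorems.BartnikGapSettlingGapExhaustionDocLocalisation
import Summits.FinalStateConjecture.FinalStateConjecture.Theorems.BartnikGapSettlingGapExhaustionKerrCoordKillingSweep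
import Summits.FinalStateConjecture.FinalStateConjecture.Theorems.BartnikGapSettlingGapExhaustionStarChartExtension
import Summits.FinalStateConjecture.FinalStateConjecture.Theorems.BartnikGapSettlingGapExhaustionInjectiveMfderivOfClose
import Summits.FinalStateConjecture.FinalStateConjecture.Theorems.BartnikGapSettlingGapExhaustionKerrBilinCoerciveExterior
import Literature.Geometry.Lorentzian.CausalityOpennessProofs
import Summits.FinalStateConjecture.FinalStateConjecture.Theorems.BartnikGapSettlingGapExhaustionRicAtChartKillingLocality
import Summits.FinalStateConjecture.FinalStateConjecture.Theorems.BartnikGapSettlingGapExhaustionContMDiffOnPushforwardField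
import Summits.FinalStateConjecture.FinalStateConjecture.Theorems.BartnikGapSettlingGapExhaustionKillingPushforwardAt
import Summits.FinalStateConjecture.FinalStateConjecture.Theorems.BartnikGapSettlingGapExhaustionKillingCoordBridge
import Summits.FinalStateConjecture.FinalStateConjecture.Theorems.BartnikGapSettlingGapExhaustionKerrBandHigherRegularity
import Summits.FinalStateConjecture.FinalStateConjecture.Theorems.BartnikGapSettlingGapExhaustionKerrCoordKillingSweepSmooth
import Summits.FinalStateConjecture.FinalStateConjecture.Theorems.BartnikGapSettlingGapExhaustionIKLocalStep
import Literature.Geometry.Lorentzian.KerrPhotonOrbitHamiltonian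
import Literature.Geometry.Lorentzian.KillingFieldLocalExtension
import Summits.FinalStateConjecture.FinalStateConjecture.Theorems.BartnikGapSettlingGapExhaustionIKLocalStepOut
import Summits.FinalStateConjecture.FinalStateConjecture.Theorems.BartnikGapSettlingGapExhaustionKerrCoordKillingSweepSmoothOut
import Summits.FinalStateConjecture.FinalStateConjecture.Theorems.BartnikGapSettlingGapExhaustionIKLocalStepUniform
import Summits.FinalStateConjecture.FinalStateConjecture.Theorems.BartnikGapSettlingGapExhaustionIKLocalStepOutUniform
import Summits.FinalStateConjecture.FinalStateConjecture.Theorems.BartnikGapSettlingGapExhaustionDocLocalisationUniform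
import Summits.FinalStateConjecture.FinalStateConjecture.Theorems.BartnikGapSettlingGapExhaustionKerrBilinCoerciveUniform
import Summits.FinalStateConjecture.FinalStateConjecture.Theorems.BartnikGapSettlingGapExhaustionLabelWindow
import Summits.FinalStateConjecture.FinalStateConjecture.Theorems.BartnikGapSettlingGapExhaustionKerrCoordKillingSweepSmoothT
import Summits.FinalStateConjecture.FinalStateConjecture.Theorems.BartnikGapSettlingGapExhaustionIKLocalStepTUniform

/-!
# Crux `GapExhaustion` (stmt-FinalStateConjecture-10808) — line `photon-shell-pseudoconvexity`
# PARKED SKELETON (no `GapExhaustion_of`; see §0) — typed two-sweep rigidity node + 7 stubs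
# rev c13 (line lead c13, 2026-08-17): (i) the node VOCABULARY (§1 shell radii / turning predicates, §2
#        `starBG … GlobalKillingPair`) is now IMPORTED from the landed `Theorems.PhotonShellNode`
#        (`…PhotonShellNodeDefs.lean`, p156510) and `IKConditionalLocalKillingExtension` is the landed
#        Literature named fact `IonescuKlainermanConditionalLocalExtension` (p153665) — bodies verbatim;
#        (ii) NEW in §3e: THE FAR COMPLETION of S6b‴ — `StubConditionalExtensionKStationaryFar`
#        (conclusion `HawkingPair K' V' ∧ IsKillingFieldOn K' (V' ∪ docOfChart)`, ONE tolerance, no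
#        radius) PROVED modulo the named fact: `conditionalExtensionKStationaryFar_of_IKC`, from the
#        rev-c12 conditional sweep (now up to `c₁ ≥ C M + 1`, keeping `∂₀ k = 0`) + the scale-free far
#        chain `Theorems.farChartExtension` (p157128) on the collar `{C M/2 < r < C M}` + chart-level
#        glue `coordField_glue` + F4; the rev-c12 `R₁`-statement is now its corollary;
#        (iii) §3f/§3g S6 RE-SPLIT: S6 ⇐ S6a‴ `StubStationaryRecharting` ⇐ S6a⁗ `StubStationaryGauge`
#        (chart level, the ONE open node: `stub_stationaryGauge`; rev c13c: FarSilent only, no clock /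
#        horizon-silence re-derivation) + S6b‴-far-silent (p162761); bookkeeping kernel-checked
#        (`stub_beltBridge_of_far`, `stationaryRecharting_of_gauge` via the landed `docOf_eq_…_sandwichU`);
#        §3c/§3d/§3e proofs LANDED as `Theorems.PhotonShellNode.*` and imported (115 kB).
# rev c12: RESHAPE of the S6/S7 interface (`docOfChart = docOf ∩ range Ψ`); §3e S6b‴ up to `R₁`
#        (`conditionalExtensionKStationary_of_IKC`) from N-6cT/V-6T/UN-6T/W2-A′T + UU-T.
# revs a2, c6–c11: see `Lines/photon-shell-pseudoconvexity-CHANGELOG.md` and the section headers below (§1b–§1g, §3b–§3d).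

Route `BartnikGapSettling`, crux decl
`Summit.FinalStateConjecture.FinalStateConjecture.Theses.BartnikGapSettling.GapExhaustion`.
Crux-planner `planner-cruxplan-stmt-FinalStateConjecture-10808-photon-shell-pseudoc-0`, 2026-08-16,
from crux idea `photon-shell-pseudoconvexity` (ideator 1; triage r1-1/r1-2/r1-3: pass ×3).

## §0  Why this file has no `GapExhaustion_of` (the line is PARKED, not registered)

The FILED text of `GapExhaustion` is false modulo the construction hypothesis
`FarWildBlackHoleExists` (`Theorems/GapExhaustion/Negative/GapExhaustionFalseOfFarWildBlackHole`,
p108531; pointer in §0 below) and vacuously true modulo junk collars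
(p106860/p116015); the lead stub of the only registered line died the same way (p115847). Every
sorry-free composition `stub₁ → … → stub_k → GapExhaustion` therefore contains a stub false modulo
`H` — a costume by the crux protocol — so NO skeleton to the filed decl is offered. The three
triagers passed the idea explicitly as a line against the RESTATED crux (`RESTATED_c4.lean`,
`GapExhaustionC4`, clause (iii): late thick collars `δ`-close to Kerr for EVERY `δ`). This file
parks, farm-checked, what that future line needs from the photon-shell mechanism:

* §1 the GEOMETRIC HEART as real algebra — the sign of `R'` at admissible roots of the null Carter
  potential off the photon shell `[r_ph⁺, r_ph⁻]`, plus the uniform gap `r₊ + 2ε ≤ r_ph⁺` on the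
  label window (`stub_kerrShellTurning` — PROVED in rev a2 from the Literature dichotomy);
* §2 the typed node `EternalSilentNearKerrIsKerr` — LOCAL RIGIDITY OF SUB-EXTREMAL KERR AMONG
  ETERNAL, DOUBLY SILENT VACUUM SPACETIMES: an eternal Ricci-flat spacetime carrying a rest-frame
  Kerr-star chart of label `(M, a)`, `|a| ≤ χM`, in which it is `δ`-close to Kerr in the
  time-uniform weighted `Cᵏ` sense (this single clause = near-Kerr + asymptotically flat +
  non-radiating towards BOTH ends of its null infinity, because a radiation field `F(u)/r` has
  `‖D²h‖ ≳ |F″|/r` along `{t* = τ}`), whose event horizon is non-expanding with surface gravity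
  `≥ κ₀ > 0` in the chart clock, is EXACTLY a Kerr spacetime on the closed d.o.c. of the charted
  region (rev a2: not on the interior strip). This is the
  Liouville half of an `ω`-limit proof of clause (iii) (the extraction half — compactness of late
  translates, `NEH` from the area law, silence at `𝓘` from Bondi mass loss — is the shared node of
  every stationary-limit route and is NOT typed here);
* §3 six analytic stubs (S2 scri ignition · S3 inward sweep · S4 horizon ignition · S5 outward
  sweep · S6 belt bridge · S7 perturbative rigidity) and the sorry-free composition
  `EternalSilentNearKerrIsKerr_of` (stub statements → node), plus `…_holds`.

Sorries (rev a2/c6/c10): exactly the six analytic `stub_*` (S2–S7); S1 is a theorem, and S5 AT EACH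
LABEL is a theorem given `IKLocalKillingExtension` (§3b). Re-register against
the restated crux item once tenure files it (the composition target then becomes
`<RestatedCrux>_of` = extraction stub + this node).

## Changelog of earlier leads (c6–c11, a2)

Moved verbatim to the crux workfile `Lines/photon-shell-pseudoconvexity-CHANGELOG.md` (rev c12b: the skeleton
exceeded the 200 kB workfile cap). In one line each: a2 — S1 proved, S7/node conclusion repaired
(`IsExactKerrOnExterior`); c6 — §1b pseudo-convexity of the cylinders kernel-checked; c7 — §1c `T`-conditional
pseudo-convexity of every cylinder, S6 split into S6a/S6b; c8 — §1d IK's quantitative Def. 3.1 for `h = r`, §1e local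
unique continuation / patching of coordinate Killing fields; c9 — §1f escape / d.o.c. localisation, §1g level-set
sweep, S4/S5 interface reshaped (uniform collar `η₄`), node audit (i)–(iii); c10 — §3b/§3c per-label sweeps S5-at /
S3-at-upTo from `IKLocalKillingExtension` (bricks N-1…N-6, NS-1…3); c11 — label-uniformity cashed: S5 and S3 are
theorems modulo the named fact (§3d/§3c), S2 reshaped to a label-level far radius `R₀`.

-/

noncomputable section

-- D-0017: single-problem summit, `Summit.<S>.<S>.…` by design (cf. lakefile `weak.linter.dupNamespace`).
set_option linter.dupNamespace false
-- instance search through the nested operator types `E4 →L[ℝ] E4 →L[ℝ] E4 →L[ℝ] ℝ`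
set_option maxSynthPendingDepth 3

namespace Summit.FinalStateConjecture.FinalStateConjecture.Cruxes.GapExhaustion.PhotonShellPseudoconvexity

open Literature.Geometry.Lorentzian
open Summit.FinalStateConjecture.FinalStateConjecture.Theorems.PhotonShellNode
open Set Filter
open scoped Manifold ContDiff Topology ENNReal

/-! ## §0  Pointer: the filed decl is false modulo `H`

The filed crux text is false modulo `FarWildBlackHoleExists` (line lead c2, p108531):
`Summit.FinalStateConjecture.FinalStateConjecture.Theorems.GapExhaustion.Negative.GapExhaustion_false_of_farWildBlackHoleExists
  : FarWildBlackHoleExists → ¬ Theses.BartnikGapSettling.GapExhaustion`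
— the reason this line is parked and not composed to `GapExhaustion`. (rev a2: the rev-1 re-export
`filed_decl_false_mod_H` of that theorem is replaced by this pointer so that the parked workfile no
longer imports the route file `Theses.BartnikGapSettling`, which is re-rendered whenever the route
moves and then blocks every `crux write` of this file until the farm is coherent again; the file now
depends on Literature modules only.) -/

/-! ## §1  The photon shell as a turning-point dichotomy (real algebra) — PROVED (rev a2)

(rev c13: the vocabulary `rPhMinus`, `rPhPlus`, `PericentresBeyond`, `ApocentresBelow` — and the whole node
vocabulary of §2 — now comes from the landed `Theorems.PhotonShellNode` (`…PhotonShellNodeDefs.lean`, p156510),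
opened above; the bodies are verbatim those of revs a2–c12.) -/

/-- Statement of `stub_kerrShellTurning` (= the registered stub `Theorems.stub_kerrShellTurning`
after unfolding `rPhPlus`, `rPhMinus`, `PericentresBeyond`, `ApocentresBelow`). -/
def StubKerrShellTurning : Prop :=
  ∀ (χ m₀ : ℝ), χ < 1 → 0 < m₀ → ∃ ε : ℝ, 0 < ε ∧
    ∀ M a : ℝ, m₀ ≤ M → M ≤ m₀⁻¹ → |a| ≤ χ * M →
      Kerr.rPlus M a + 2 * ε ≤ rPhPlus M a ∧
      PericentresBeyond M a (rPhMinus M a) ∧ ApocentresBelow M a (rPhPlus M a)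

/-- **Stub 1 (ALG) — PROVED (rev a2).** On the compact label window `m₀ ≤ M ≤ m₀⁻¹`, `|a| ≤ χM`
(`χ < 1`) there is `ε > 0` with `r₊ + 2ε ≤ r_ph⁺(M,a)`, and for every such label every
Θ-admissible root `c` of the null Carter potential with `c > r_ph⁻(M,a)` has `R′(c) > 0`
(pericentre), while every root with `r₊ < c < r_ph⁺(M,a)` has `R′(c) < 0` (apocentre). Proof in
`Literature/Geometry/Lorentzian/KerrPhotonShellTurningPoints.lean` (dichotomy, via
`ΔR′ = 2PG` and the sign of Sbierski's cubic) and `KerrNullRadialPotential.lean` (gap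
`r₊ + M(1 − χ²)/3 ≤ r_ph⁺`); here `ε := m₀(1 − χ²)/6` (`χ ≥ 0`; `ε := 1` in the vacuous case
`χ < 0`). The `ε` of this stub is the one the sweeps (3), (5) and the belt (6) are run at. -/
theorem stub_kerrShellTurning : StubKerrShellTurning := by
  intro χ m₀ hχ hm₀
  by_cases hχ0 : 0 ≤ χ
  · have hχ2 : 0 < 1 - χ ^ 2 := by nlinarith
    refine ⟨m₀ * (1 - χ ^ 2) / 6, div_pos (mul_pos hm₀ hχ2) (by norm_num), ?_⟩
    intro M a hM hM' ha
    have hMpos : 0 < M := hm₀.trans_le hM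
    have haM : |a| < M := by nlinarith [abs_nonneg a]
    refine ⟨?_, fun E L Q c hc hadm hne hroot =>
        Kerr.deriv_nullRadialPotential_pos_of_photonOrbitRadius_lt hMpos haM hc hadm hne hroot,
      fun E L Q c hc₁ hc₂ hadm hne hroot =>
        Kerr.deriv_nullRadialPotential_neg_of_lt_photonOrbitRadius_neg hMpos haM hc₁ hc₂ hadm hne
          hroot⟩
    have hgap := Kerr.rPlus_add_le_photonOrbitRadius_neg hMpos hχ0 hχ ha
    have : m₀ * (1 - χ ^ 2) ≤ M * (1 - χ ^ 2) := mul_le_mul_of_nonneg_right hM hχ2.le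
    show Kerr.rPlus M a + 2 * (m₀ * (1 - χ ^ 2) / 6) ≤ Kerr.photonOrbitRadius M (-|a|)
    linarith
  · refine ⟨1, one_pos, ?_⟩
    intro M a hM _ ha
    exfalso
    have hMpos : 0 < M := hm₀.trans_le hM
    have : χ * M < 0 := mul_neg_of_neg_of_pos (not_le.mp hχ0) hMpos
    linarith [abs_nonneg a]

/-! ## §1b  The geometric form of §1 — PROVED (rev c6) -/

/-- **Inward pseudo-convexity of the cylinders below the inner photon orbit, exact Kerr, every point
(rev c6).** For `0 < M`, `|a| < M`, at every point `z` of Kerr–Schild coordinate space with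
`r₊ < r(z) < r_ph⁺ = rPhPlus M a` every non-zero vector null for `g_{M,a}` and tangent to
`{r = r(z)}` has `Hess r(w,w) < 0` (`MetricCoord.hessAt` of `Kerr.radius` for `Kerr.bilin`).
This is `ApocentresBelow` read geometrically (`Hess r = R′/(2Σ²)`); S5's hypersurface condition. -/
theorem apocentresBelow_geometric {M a : ℝ} (hM : 0 < M) (ha : |a| < M) {z : E4}
    (hz₁ : Kerr.rPlus M a < Kerr.radius a z) (hz₂ : Kerr.radius a z < rPhPlus M a) {w : E4}
    (hw : w ≠ 0) (hnull : Kerr.bilin M a z w w = 0) (htan : fderiv ℝ (Kerr.radius a) z w = 0) :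
    MetricCoord.hessAt (Kerr.bilin M a) (Kerr.radius a) z w w < 0 :=
  Kerr.hessAt_radius_neg hM ha hz₁ hz₂ hw hnull htan

/-- **Outward pseudo-convexity beyond the outer photon orbit, exact Kerr, every point (rev c6)**:
for `r(z) > r_ph⁻ = rPhMinus M a` every non-zero null tangent vector has `Hess r(w,w) > 0` —
`PericentresBeyond` read geometrically; S3's hypersurface condition. -/
theorem pericentresBeyond_geometric {M a : ℝ} (hM : 0 < M) (ha : |a| < M) {z : E4}
    (hz : rPhMinus M a < Kerr.radius a z) {w : E4} (hw : w ≠ 0) (hnull : Kerr.bilin M a z w w = 0)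
    (htan : fderiv ℝ (Kerr.radius a) z w = 0) :
    0 < MetricCoord.hessAt (Kerr.bilin M a) (Kerr.radius a) z w w :=
  Kerr.hessAt_radius_pos hM ha hz hw hnull htan

/-- **The inner claim in `C²`-stable form over arbitrary spacetimes — PROVED (rev c6).** For a band
`r₊ < r_lo < r_e < r_ph⁺` there are `δ, μ > 0` such that for EVERY time-oriented spacetime `𝓢` and
every smooth chart `Φ` of the eternal star region `{M < r < 4M}`, an open embedding of it, whose
pulled-back components `𝓢.metricInCoords Φ` are `δ`-close in `C²` sup norm to the Kerr–Schild form
on the band, the coordinate Hessian of `r` w.r.t. those components is `≤ −μ‖w‖²` on every null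
tangent vector at every band point (all times): the strong null pseudo-convexity that an
Ionescu–Klainerman sweep (S5) crosses. = eternal-redshift-rigidity's `KerrCylindersBendInward`
(rev c6 form), composed from the registered sub-stubs (B) `stub_kerrCylindersExactMargin`,
(C) `stub_hessMarginStable`, (E) `stub_kerrCylindersBendInward_of`. -/
theorem kerrCylindersBendInwardKS :
    ∀ (M a r_lo r_e : ℝ), 0 < M → |a| < M → Kerr.rPlus M a < r_lo → r_lo < r_e →
      r_e < Kerr.photonOrbitRadius M (-|a|) →
      ∃ (δ μ : ℝ), 0 < δ ∧ 0 < μ ∧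
      ∀ (𝓢 : Spacetime.{0} 4) (Φ : E4 → 𝓢.carrier),
        ContMDiffOn 𝓘(ℝ, E4) (𝓡 4) ∞ Φ {z | M < Kerr.radius a z ∧ Kerr.radius a z < 4 * M} →
        Topology.IsOpenEmbedding
          ({z : E4 | M < Kerr.radius a z ∧ Kerr.radius a z < 4 * M}.restrict Φ) →
        supCkENorm {z | (M < Kerr.radius a z ∧ Kerr.radius a z < 4 * M) ∧
            r_lo ≤ Kerr.radius a z ∧ Kerr.radius a z ≤ r_e} 2
            (fun z => 𝓢.metricInCoords Φ z - Kerr.bilin M a z) ≤ ENNReal.ofReal δ →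
        ∀ z ∈ {z : E4 | M < Kerr.radius a z ∧ Kerr.radius a z < 4 * M}, ∀ w : E4,
          r_lo ≤ Kerr.radius a z → Kerr.radius a z ≤ r_e →
          𝓢.metricInCoords Φ z w w = 0 → fderiv ℝ (Kerr.radius a) z w = 0 →
          MetricCoord.hessAt (𝓢.metricInCoords Φ) (Kerr.radius a) z w w ≤ -μ * ‖w‖ ^ 2 :=
  Theorems.stub_kerrCylindersBendInward_of Theorems.stub_kerrCylindersExactMargin
    Theorems.stub_hessMarginStable

/-- **The outer claim in `C²`-stable form (S3's hypersurface condition) — PROVED (rev c7).** For a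
band `r_ph⁻ < r_lo < r_e` there are `δ, μ > 0` such that for every spacetime chart `Φ` on the star
region `{r > M}` whose pulled-back components are `δ`-close in `C²` sup norm to the Kerr–Schild form
on the band, `Hess r(w,w) ≥ μ‖w‖²` on every null tangent vector at every band point (all times):
the strong null pseudo-convexity towards `{r > c}` that the inward sweep S3 crosses. Registered
sub-stub (O-E) `stub_kerrCylindersBendOutward_of` (p126567) composed with c6's
`kerrCylindersExactMarginOut` and (C) `stub_hessMarginStable` (the tree's
`Theorems.kerrCylindersBendOutwardKS`). -/
theorem kerrCylindersBendOutwardStable :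
    ∀ (M a r_lo r_e : ℝ), 0 < M → |a| < M → Kerr.photonOrbitRadius M |a| < r_lo → r_lo < r_e →
      ∃ (δ μ : ℝ), 0 < δ ∧ 0 < μ ∧
      ∀ (𝓢 : Spacetime.{0} 4) (Φ : E4 → 𝓢.carrier),
        ContMDiffOn 𝓘(ℝ, E4) (𝓡 4) ∞ Φ {z | M < Kerr.radius a z} →
        Topology.IsOpenEmbedding ({z : E4 | M < Kerr.radius a z}.restrict Φ) →
        supCkENorm {z | M < Kerr.radius a z ∧ r_lo ≤ Kerr.radius a z ∧ Kerr.radius a z ≤ r_e} 2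
            (fun z => 𝓢.metricInCoords Φ z - Kerr.bilin M a z) ≤ ENNReal.ofReal δ →
        ∀ (z w : E4), r_lo ≤ Kerr.radius a z → Kerr.radius a z ≤ r_e →
          𝓢.metricInCoords Φ z w w = 0 → fderiv ℝ (Kerr.radius a) z w = 0 →
          μ * ‖w‖ ^ 2 ≤ MetricCoord.hessAt (𝓢.metricInCoords Φ) (Kerr.radius a) z w w :=
  Theorems.kerrCylindersBendOutwardKS

/-! ## §1c  `T`-conditional pseudo-convexity of EVERY cylinder beyond the horizon — PROVED (rev c7)

Ionescu–Klainerman (Invent. Math. 175 (2009), §3.1) weaken Hörmander's condition to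
(HoCond2): `T(h) = 0` and `D²h(X,X) < 0` for all `X ≠ 0` with `g(X,X) = g(X,∇h) = g(T,X) = 0`;
unique continuation of `T`-invariant tensors (and, in Alexakis–Ionescu–Klainerman CMP 299 (2010),
the extension of the Hawking Killing field in a STATIONARY near-Kerr exterior) across the level sets
of `h` needs only this. For `h = r` it holds in exact Kerr at EVERY radius `c > r₊` — the photon
shell is no obstruction for zero-energy null vectors — and it is stable under `C¹`-perturbation of
the components and `C⁰`-perturbation of `T`. -/

/-- **Zero-energy null tangent vectors bend inward at every radius beyond the horizon, exact Kerr,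
every point (rev c7).** For `0 < M`, `|a| < M`, `r(z) > r₊`: every non-zero `w` null for `g_{M,a}`,
tangent to `{r = r(z)}` and orthogonal to the stationary field `∂₀` has `Hess r(w,w) < 0`
(`R′ = −2(r − M)(Q + L²)` at `E = 0`). Literature `Kerr.hessAt_radius_neg_of_bilin_basisVector_zero`
(p126298). Outside the ergoregion the hypothesis is empty; inside it is IK's (HoCond2) for `h = r`. -/
theorem zeroEnergyBending_geometric {M a : ℝ} (hM : 0 < M) (ha : |a| < M) {z : E4}
    (hz : Kerr.rPlus M a < Kerr.radius a z) {w : E4} (hw : w ≠ 0)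
    (hnull : Kerr.bilin M a z w w = 0) (htan : fderiv ℝ (Kerr.radius a) z w = 0)
    (horth : Kerr.bilin M a z (E4.basisVector 0) w = 0) :
    MetricCoord.hessAt (Kerr.bilin M a) (Kerr.radius a) z w w < 0 :=
  Kerr.hessAt_radius_neg_of_bilin_basisVector_zero hM ha.le hz hw hnull htan horth

/-- **`T`-conditional inward bending in `C¹`-stable chart form, every band beyond the horizon —
PROVED (rev c7).** For a band `r₊ < r_lo < r_e` (ANY `r_e`: the belt `[r_ph⁺ − ε, r_ph⁻ + ε]`
included) there are `δ, μ > 0` such that for every spacetime chart `Φ` on `{r > M}` whose pulled-back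
components are `δ`-close in `C²` sup norm to the Kerr–Schild form on the band, and every
conditioning field `T` on the band with `‖T − ∂₀‖ ≤ δ`, the coordinate Hessian of `r` is
`≤ −μ‖w‖²` on every vector that is null, tangent to the cylinder and `Φ^*g`-orthogonal to `T`, at
every band point (all times). This is the hypersurface condition of the `T`-conditional Carleman
sweep of S6b (`StubConditionalExtensionK`) / of AIK's perturbative rigidity (S7). Composition of the
registered sub-stubs (T-B) `stub_kerrZeroEnergyExactMargin` (p126489), (T-C)
`stub_hessMarginStableLin` (p126535), (T-E) `stub_kerrZeroEnergyBendInward_of` (p126518). -/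
theorem kerrZeroEnergyBendInwardKS :
    ∀ (M a r_lo r_e : ℝ), 0 < M → |a| < M → Kerr.rPlus M a < r_lo → r_lo < r_e →
      ∃ (δ μ : ℝ), 0 < δ ∧ 0 < μ ∧
      ∀ (𝓢 : Spacetime.{0} 4) (Φ : E4 → 𝓢.carrier) (T : E4 → E4),
        ContMDiffOn 𝓘(ℝ, E4) (𝓡 4) ∞ Φ {z | M < Kerr.radius a z} →
        Topology.IsOpenEmbedding ({z : E4 | M < Kerr.radius a z}.restrict Φ) →
        supCkENorm {z | M < Kerr.radius a z ∧ r_lo ≤ Kerr.radius a z ∧ Kerr.radius a z ≤ r_e} 2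
            (fun z => 𝓢.metricInCoords Φ z - Kerr.bilin M a z) ≤ ENNReal.ofReal δ →
        (∀ z : E4, r_lo ≤ Kerr.radius a z → Kerr.radius a z ≤ r_e → ‖T z - E4.basisVector 0‖ ≤ δ) →
        ∀ (z w : E4), r_lo ≤ Kerr.radius a z → Kerr.radius a z ≤ r_e →
          𝓢.metricInCoords Φ z w w = 0 → fderiv ℝ (Kerr.radius a) z w = 0 →
          𝓢.metricInCoords Φ z (T z) w = 0 →
          MetricCoord.hessAt (𝓢.metricInCoords Φ) (Kerr.radius a) z w w ≤ -μ * ‖w‖ ^ 2 :=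
  Theorems.stub_kerrZeroEnergyBendInward_of Theorems.stub_kerrZeroEnergyExactMargin
    Theorems.stub_hessMarginStableLin

/-! ## §1d  Ionescu–Klainerman's QUANTITATIVE `T`-conditional pseudo-convexity (Invent. Math. 175
(2009), Definition 3.1) for `h = r` on every Kerr band beyond the horizon — PROVED (rev c8)

Definition 3.1 of IK 2009 asks, at a point `x₀` and for a constant `ε₁ ∈ (0, A₀⁻¹]`: (po3) a
multiplier `μ ∈ [−ε₁⁻¹, ε₁⁻¹]` with `ε₁²|X|² ≤ X^αX^β(μ g_{αβ} − D_αD_βh) + ε⁻²(|X^αV_α|² + |X^αD_αh|²)`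
for all `X` (we prove it with `ε = ε₁`; a smaller `ε` only enlarges the penalty), and (po3.2) the
non-characteristic bound `D^αh D^βh(D_αh D_βh − ε D_αD_βh) ≥ ε₁²`. For `h = r`, `V = T` both hold on
every band `r₊ < r_lo ≤ r ≤ r_e`, uniformly and perturbation-stably. -/

/-- **(po3) for `h = r` on every Kerr band, `C²`-stable in the chart and `C⁰`-stable in `T` —
PROVED (rev c8).** For `0 < M`, `|a| < M` and a band `r₊ < r_lo < r_e` there are `δ, ε₁ > 0` such
that for every spacetime chart `Φ` on `{r > M}` whose pulled-back components are `δ`-close in `C²`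
sup norm to the Kerr–Schild form on the band and every conditioning field `T` with `‖T − ∂₀‖ ≤ δ`
on the band, at every band point (all times) there is `μ ∈ [−ε₁⁻¹, ε₁⁻¹]` with
`ε₁²‖w‖² ≤ μ g(w,w) − Hess r(w,w) + ε₁⁻²(g(T,w)² + dr(w)²)` for ALL `w` — condition (po3) of
Ionescu–Klainerman, Invent. Math. 175 (2009), Def. 3.1 with `V = T`, `h = r`. Composition of the
registered sub-stubs (P-1) `stub_multiplierFormStable` and (P-2) `stub_kerrConditionalMultiplier_of`. -/
theorem kerrConditionalMultiplierKS :
    ∀ (M a r_lo r_e : ℝ), 0 < M → |a| < M → Kerr.rPlus M a < r_lo → r_lo < r_e →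
      ∃ (δ ε₁ : ℝ), 0 < δ ∧ 0 < ε₁ ∧
      ∀ (𝓢 : Spacetime.{0} 4) (Φ : E4 → 𝓢.carrier) (T : E4 → E4),
        ContMDiffOn 𝓘(ℝ, E4) (𝓡 4) ∞ Φ {z | M < Kerr.radius a z} →
        Topology.IsOpenEmbedding ({z : E4 | M < Kerr.radius a z}.restrict Φ) →
        supCkENorm {z | M < Kerr.radius a z ∧ r_lo ≤ Kerr.radius a z ∧ Kerr.radius a z ≤ r_e} 2
            (fun z => 𝓢.metricInCoords Φ z - Kerr.bilin M a z) ≤ ENNReal.ofReal δ →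
        (∀ z : E4, r_lo ≤ Kerr.radius a z → Kerr.radius a z ≤ r_e → ‖T z - E4.basisVector 0‖ ≤ δ) →
        ∀ z : E4, r_lo ≤ Kerr.radius a z → Kerr.radius a z ≤ r_e →
          ∃ μ : ℝ, |μ| ≤ ε₁⁻¹ ∧ ∀ w : E4,
            ε₁ ^ 2 * ‖w‖ ^ 2 ≤ μ * 𝓢.metricInCoords Φ z w w
              - MetricCoord.hessAt (𝓢.metricInCoords Φ) (Kerr.radius a) z w w
              + ε₁⁻¹ ^ 2 * ((𝓢.metricInCoords Φ z (T z) w) ^ 2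
                + (fderiv ℝ (Kerr.radius a) z w) ^ 2) :=
  Theorems.stub_kerrConditionalMultiplier_of Theorems.stub_multiplierFormStable

/-- **(po3.2) for `h = r` on every Kerr band, `C²`-stable in the chart — PROVED (rev c8).** For a
band `r₊ < r_lo < r_e` there are `δ, ε₁ > 0` such that for every spacetime chart `Φ` on `{r > M}`
`δ`-close in `C²` sup norm to the Kerr–Schild form on the band, at every band point (all times) and
for every `0 < ε ≤ ε₁`: `ε₁² ≤ (dr(♯dr))² − ε Hess r(♯dr, ♯dr)`, `♯dr = sharpAt (Φ^*g) z dr_z` the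
metric gradient — condition (po3.2) of IK 2009 Def. 3.1 (`D^αh D^βh(D_αh D_βh − ε D_αD_βh) ≥ ε₁²`).
In exact Kerr `dr(♯dr) = g^{rr} = Δ/Σ > 0` beyond `r₊` (`Kerr.bilin_radiusGradVector_self`).
Composition of (P-3) `stub_kerrRadiusNoncharacteristic`, (P-4) `stub_noncharStable`,
(P-5) `stub_kerrNoncharacteristic_of`. -/
theorem kerrNoncharacteristicKS :
    ∀ (M a r_lo r_e : ℝ), 0 < M → |a| < M → Kerr.rPlus M a < r_lo → r_lo < r_e →
      ∃ (δ ε₁ : ℝ), 0 < δ ∧ 0 < ε₁ ∧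
      ∀ (𝓢 : Spacetime.{0} 4) (Φ : E4 → 𝓢.carrier),
        ContMDiffOn 𝓘(ℝ, E4) (𝓡 4) ∞ Φ {z | M < Kerr.radius a z} →
        Topology.IsOpenEmbedding ({z : E4 | M < Kerr.radius a z}.restrict Φ) →
        supCkENorm {z | M < Kerr.radius a z ∧ r_lo ≤ Kerr.radius a z ∧ Kerr.radius a z ≤ r_e} 2
            (fun z => 𝓢.metricInCoords Φ z - Kerr.bilin M a z) ≤ ENNReal.ofReal δ →
        ∀ z : E4, r_lo ≤ Kerr.radius a z → Kerr.radius a z ≤ r_e →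
        ∀ ε : ℝ, 0 < ε → ε ≤ ε₁ →
          ε₁ ^ 2 ≤ (fderiv ℝ (Kerr.radius a) z
              (MetricCoord.sharpAt (𝓢.metricInCoords Φ) z (fderiv ℝ (Kerr.radius a) z))) ^ 2
            - ε * MetricCoord.hessAt (𝓢.metricInCoords Φ) (Kerr.radius a) z
              (MetricCoord.sharpAt (𝓢.metricInCoords Φ) z (fderiv ℝ (Kerr.radius a) z))
              (MetricCoord.sharpAt (𝓢.metricInCoords Φ) z (fderiv ℝ (Kerr.radius a) z)) :=
  Theorems.stub_kerrNoncharacteristic_of Theorems.stub_kerrRadiusNoncharacteristic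
    Theorems.stub_noncharStable

/-- **Definition 3.1 of Ionescu–Klainerman (Invent. Math. 175 (2009)) for `h = r`, `V = T`, both
point conditions with ONE pair `(δ, ε₁)` per band — PROVED (rev c8).** (po3) and (po3.2) hold
simultaneously, at every point of every band `r₊ < r_lo ≤ r ≤ r_e`, all times, for every chart
`δ`-close in `C²` to Kerr–Schild on the band and every `T` with `‖T − ∂₀‖ ≤ δ` there: take the
smaller `δ` and the smaller `ε₁` of `kerrConditionalMultiplierKS` / `kerrNoncharacteristicKS`
(both conditions are monotone under shrinking `ε₁`). This is the complete hypersurface/weight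
input about KERR of the `T`-conditional Carleman estimate (IK 2009 Prop. 3.3) consumed by S6b
(`StubConditionalExtensionK`) and S7; what those stubs still import from the literature is the
analytic estimate itself. [folklore] -/
theorem kerrQuantitativeConditionalPseudoconvexity :
    ∀ (M a r_lo r_e : ℝ), 0 < M → |a| < M → Kerr.rPlus M a < r_lo → r_lo < r_e →
      ∃ (δ ε₁ : ℝ), 0 < δ ∧ 0 < ε₁ ∧
      ∀ (𝓢 : Spacetime.{0} 4) (Φ : E4 → 𝓢.carrier) (T : E4 → E4),
        ContMDiffOn 𝓘(ℝ, E4) (𝓡 4) ∞ Φ {z | M < Kerr.radius a z} →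
        Topology.IsOpenEmbedding ({z : E4 | M < Kerr.radius a z}.restrict Φ) →
        supCkENorm {z | M < Kerr.radius a z ∧ r_lo ≤ Kerr.radius a z ∧ Kerr.radius a z ≤ r_e} 2
            (fun z => 𝓢.metricInCoords Φ z - Kerr.bilin M a z) ≤ ENNReal.ofReal δ →
        (∀ z : E4, r_lo ≤ Kerr.radius a z → Kerr.radius a z ≤ r_e → ‖T z - E4.basisVector 0‖ ≤ δ) →
        ∀ z : E4, r_lo ≤ Kerr.radius a z → Kerr.radius a z ≤ r_e →
          (∃ μ : ℝ, |μ| ≤ ε₁⁻¹ ∧ ∀ w : E4,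
            ε₁ ^ 2 * ‖w‖ ^ 2 ≤ μ * 𝓢.metricInCoords Φ z w w
              - MetricCoord.hessAt (𝓢.metricInCoords Φ) (Kerr.radius a) z w w
              + ε₁⁻¹ ^ 2 * ((𝓢.metricInCoords Φ z (T z) w) ^ 2
                + (fderiv ℝ (Kerr.radius a) z w) ^ 2)) ∧
          (∀ ε : ℝ, 0 < ε → ε ≤ ε₁ →
            ε₁ ^ 2 ≤ (fderiv ℝ (Kerr.radius a) z
                (MetricCoord.sharpAt (𝓢.metricInCoords Φ) z (fderiv ℝ (Kerr.radius a) z))) ^ 2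
              - ε * MetricCoord.hessAt (𝓢.metricInCoords Φ) (Kerr.radius a) z
                (MetricCoord.sharpAt (𝓢.metricInCoords Φ) z (fderiv ℝ (Kerr.radius a) z))
                (MetricCoord.sharpAt (𝓢.metricInCoords Φ) z (fderiv ℝ (Kerr.radius a) z))) := by
  intro M a r_lo r_e hM ha hlo hloe
  obtain ⟨δ₁, ε₁, hδ₁, hε₁, H₁⟩ := kerrConditionalMultiplierKS M a r_lo r_e hM ha hlo hloe
  obtain ⟨δ₂, ε₂, hδ₂, hε₂, H₂⟩ := kerrNoncharacteristicKS M a r_lo r_e hM ha hlo hloe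
  refine ⟨min δ₁ δ₂, min ε₁ ε₂, lt_min hδ₁ hδ₂, lt_min hε₁ hε₂, ?_⟩
  intro 𝓢 Φ T hΦ hemb hsup hT z hzlo hze
  have hε : 0 < min ε₁ ε₂ := lt_min hε₁ hε₂
  have hsup₁ : supCkENorm {z | M < Kerr.radius a z ∧ r_lo ≤ Kerr.radius a z ∧
      Kerr.radius a z ≤ r_e} 2 (fun z => 𝓢.metricInCoords Φ z - Kerr.bilin M a z) ≤
      ENNReal.ofReal δ₁ :=
    hsup.trans (ENNReal.ofReal_le_ofReal (min_le_left _ _))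
  have hsup₂ : supCkENorm {z | M < Kerr.radius a z ∧ r_lo ≤ Kerr.radius a z ∧
      Kerr.radius a z ≤ r_e} 2 (fun z => 𝓢.metricInCoords Φ z - Kerr.bilin M a z) ≤
      ENNReal.ofReal δ₂ :=
    hsup.trans (ENNReal.ofReal_le_ofReal (min_le_right _ _))
  have hT₁ : ∀ z : E4, r_lo ≤ Kerr.radius a z → Kerr.radius a z ≤ r_e →
      ‖T z - E4.basisVector 0‖ ≤ δ₁ :=
    fun z h₁ h₂ => (hT z h₁ h₂).trans (min_le_left _ _)
  constructor
  · -- (po3) is monotone under shrinking `ε₁`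
    obtain ⟨μ, hμ, hall⟩ := H₁ 𝓢 Φ T hΦ hemb hsup₁ hT₁ z hzlo hze
    have hinv : ε₁⁻¹ ≤ (min ε₁ ε₂)⁻¹ := by
      rw [inv_le_inv₀ hε₁ hε]
      exact min_le_left _ _
    refine ⟨μ, hμ.trans hinv, fun w => ?_⟩
    have h1 : min ε₁ ε₂ ^ 2 * ‖w‖ ^ 2 ≤ ε₁ ^ 2 * ‖w‖ ^ 2 :=
      mul_le_mul_of_nonneg_right (pow_le_pow_left₀ hε.le (min_le_left _ _) 2) (sq_nonneg _)
    have h2 : ε₁⁻¹ ^ 2 * ((𝓢.metricInCoords Φ z (T z) w) ^ 2 + (fderiv ℝ (Kerr.radius a) z w) ^ 2)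
        ≤ (min ε₁ ε₂)⁻¹ ^ 2 *
          ((𝓢.metricInCoords Φ z (T z) w) ^ 2 + (fderiv ℝ (Kerr.radius a) z w) ^ 2) :=
      mul_le_mul_of_nonneg_right (pow_le_pow_left₀ (inv_nonneg.2 hε₁.le) hinv 2) (by positivity)
    linarith [hall w]
  · -- (po3.2) is monotone under shrinking `ε₁`
    intro ε hε0 hεle
    have h := H₂ 𝓢 Φ hΦ hemb hsup₂ z hzlo hze ε hε0 (hεle.trans (min_le_right _ _))
    have h1 : min ε₁ ε₂ ^ 2 ≤ ε₂ ^ 2 := pow_le_pow_left₀ hε.le (min_le_right _ _) 2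
    linarith

/-- **The UNCONDITIONAL multiplier form below the photon shell — PROVED (rev c8b/c9;
Ionescu–Klainerman, JAMS 26 (2013), Lemma 2.11 (a), the hypothesis of THEIR extension Theorem 1.2
invoked by S5, for `f = r − c`, `r₊ < c < r_ph⁺`).** On every band `r₊ < r_lo ≤ r ≤ r_e < r_ph⁺`
and for every chart `C²`-`δ`-close to Kerr on it: `∃ μ ∈ [−ε₁⁻¹, ε₁⁻¹]`,
`ε₁²‖w‖² ≤ μ g(w,w) − Hess r(w,w) + ε₁⁻² dr(w)²` for ALL `w`, at all times ((U-in)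
`Theorems.stub_kerrMultiplierBelowShell`, p128795). -/
theorem kerrMultiplierBelowShellKS :
    ∀ (M a r_lo r_e : ℝ), 0 < M → |a| < M → Kerr.rPlus M a < r_lo → r_lo < r_e →
      r_e < Kerr.photonOrbitRadius M (-|a|) →
      ∃ (δ ε₁ : ℝ), 0 < δ ∧ 0 < ε₁ ∧
      ∀ (𝓢 : Spacetime.{0} 4) (Φ : E4 → 𝓢.carrier),
        ContMDiffOn 𝓘(ℝ, E4) (𝓡 4) ∞ Φ {z | M < Kerr.radius a z} →
        Topology.IsOpenEmbedding ({z : E4 | M < Kerr.radius a z}.restrict Φ) →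
        supCkENorm {z | M < Kerr.radius a z ∧ r_lo ≤ Kerr.radius a z ∧ Kerr.radius a z ≤ r_e} 2
            (fun z => 𝓢.metricInCoords Φ z - Kerr.bilin M a z) ≤ ENNReal.ofReal δ →
        ∀ z : E4, r_lo ≤ Kerr.radius a z → Kerr.radius a z ≤ r_e →
          ∃ μ : ℝ, |μ| ≤ ε₁⁻¹ ∧ ∀ w : E4,
            ε₁ ^ 2 * ‖w‖ ^ 2 ≤ μ * 𝓢.metricInCoords Φ z w w
              - MetricCoord.hessAt (𝓢.metricInCoords Φ) (Kerr.radius a) z w w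
              + ε₁⁻¹ ^ 2 * (fderiv ℝ (Kerr.radius a) z w) ^ 2 :=
  Theorems.stub_kerrMultiplierBelowShell

/-- **The UNCONDITIONAL multiplier form beyond the photon shell — PROVED (rev c8b/c9; IK JAMS 26
(2013), Lemma 2.11 (a) with the outward sign, the hypothesis of Thm 1.2 as invoked by S3, for
`f = c − r`, `c > r_ph⁻`).** On every band `r_ph⁻ < r_lo ≤ r ≤ r_e` and for every chart
`C²`-`δ`-close to Kerr on it: `∃ μ ∈ [−ε₁⁻¹, ε₁⁻¹]`,
`ε₁²‖w‖² ≤ μ g(w,w) + Hess r(w,w) + ε₁⁻² dr(w)²` for ALL `w` ((U-out)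
`Theorems.stub_kerrMultiplierBeyondShell`, p128819). -/
theorem kerrMultiplierBeyondShellKS :
    ∀ (M a r_lo r_e : ℝ), 0 < M → |a| < M → Kerr.photonOrbitRadius M |a| < r_lo → r_lo < r_e →
      ∃ (δ ε₁ : ℝ), 0 < δ ∧ 0 < ε₁ ∧
      ∀ (𝓢 : Spacetime.{0} 4) (Φ : E4 → 𝓢.carrier),
        ContMDiffOn 𝓘(ℝ, E4) (𝓡 4) ∞ Φ {z | M < Kerr.radius a z} →
        Topology.IsOpenEmbedding ({z : E4 | M < Kerr.radius a z}.restrict Φ) →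
        supCkENorm {z | M < Kerr.radius a z ∧ r_lo ≤ Kerr.radius a z ∧ Kerr.radius a z ≤ r_e} 2
            (fun z => 𝓢.metricInCoords Φ z - Kerr.bilin M a z) ≤ ENNReal.ofReal δ →
        ∀ z : E4, r_lo ≤ Kerr.radius a z → Kerr.radius a z ≤ r_e →
          ∃ μ : ℝ, |μ| ≤ ε₁⁻¹ ∧ ∀ w : E4,
            ε₁ ^ 2 * ‖w‖ ^ 2 ≤ μ * 𝓢.metricInCoords Φ z w w
              + MetricCoord.hessAt (𝓢.metricInCoords Φ) (Kerr.radius a) z w w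
              + ε₁⁻¹ ^ 2 * (fderiv ℝ (Kerr.radius a) z w) ^ 2 :=
  Theorems.stub_kerrMultiplierBeyondShell

/-! ## §1e  LOCAL unique continuation and patching of coordinate Killing fields — PROVED (rev c8)

The sweeps S3/S5/S6b globalise a LOCAL extension theorem (IK JAMS 26 (2013) Thm 1.2 / Surveys 20
(2015) Thm 2.4) over the foliation by cylinders; local extensions obtained near different points of
a leaf are patched by UNIQUE CONTINUATION of Killing fields: a Killing field is determined, on a
connected open set, by its 1-jet at one point (O'Neill 1983, Ch. 9, Lemma 9.27). In the chart
vocabulary of the node (`metricInCoords`-type components `G` on open subsets of `E4`) this is: -/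

/-- **The prolongation of the coordinate Killing equation — PROVED (rev c8).** For the components
`G` of a pseudo-Riemannian metric on the open `V ⊆ E4` and a `C²` solution `K` of the coordinate
Killing equation on `V`, with `A_y Y = DK(y) Y + Γ_y(Y, K y)` (`= ∇_Y K`):
`∂_X(A·Y)(x) = R_x(X, K x) Y − Γ_x(X, A_x Y) + A_x(Γ_x(X, Y))`, i.e. `(∇_X ∇K)(Y) = R(X,K)Y`
(O'Neill 1983, Ch. 9, Exercise 8). Composition of (K-A4) with (K-A1)/(K-A2)/(K-A3). -/
theorem killingProlongation :
    ∀ (G : E4 → E4 →L[ℝ] E4 →L[ℝ] ℝ) (V : Set E4) (K : E4 → E4),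
      MetricCoord.IsMetricOn G V → ContDiffOn ℝ 2 K V →
      (∀ x ∈ V, ∀ Y Z : E4,
        fderiv ℝ G x (K x) Y Z + G x (fderiv ℝ K x Y) Z + G x Y (fderiv ℝ K x Z) = 0) →
      ∀ x ∈ V, ∀ X Y : E4,
        fderiv ℝ (fun y => fderiv ℝ K y Y + MetricCoord.chrAt G y Y (K y)) x X =
          MetricCoord.riemAt G x X (K x) Y
            - MetricCoord.chrAt G x X (fderiv ℝ K x Y + MetricCoord.chrAt G x Y (K x))
            + (fderiv ℝ K x (MetricCoord.chrAt G x X Y)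
              + MetricCoord.chrAt G x (MetricCoord.chrAt G x X Y) (K x)) :=
  Theorems.stub_killingProlongation_of Theorems.stub_killingHessianSkew
    Theorems.stub_killingHessianAlt Theorems.stub_curvatureLikeAlgebra

/-- **LOCAL unique continuation of coordinate Killing fields (vanishing form) — PROVED (rev c8).**
A `C²` solution of the coordinate Killing equation on a CONNECTED open `V ⊆ E4` whose 1-jet
vanishes at one point of `V` vanishes on `V` (O'Neill 1983, Ch. 9, Lemma 9.27, local form).
Composition of (K-D) with `killingProlongation`, (K-B) and (K-C). -/
theorem killingUniqueContinuation :
    ∀ (G : E4 → E4 →L[ℝ] E4 →L[ℝ] ℝ) (V : Set E4) (K : E4 → E4) (x₀ : E4),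
      MetricCoord.IsMetricOn G V → IsConnected V → ContDiffOn ℝ 2 K V →
      (∀ x ∈ V, ∀ Y Z : E4,
        fderiv ℝ G x (K x) Y Z + G x (fderiv ℝ K x Y) Z + G x Y (fderiv ℝ K x Z) = 0) →
      x₀ ∈ V → K x₀ = 0 → fderiv ℝ K x₀ = 0 →
      ∀ x ∈ V, K x = 0 :=
  Theorems.stub_killingUniqueContinuation_of killingProlongation Theorems.stub_firstOrderVanishing
    Theorems.stub_killingJetBound_of

/-- **Patching of coordinate Killing fields — PROVED (rev c8).** Two `C²` solutions of the
coordinate Killing equation on a connected open `V ⊆ E4` which agree on a nonempty open subset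
`U ⊆ V` agree on `V`. This is the form in which S3/S5/S6b consume unique continuation when gluing
local extensions into a global one. Composition of (K-E) with `killingUniqueContinuation`. -/
theorem killingPatching :
    ∀ (G : E4 → E4 →L[ℝ] E4 →L[ℝ] ℝ) (V U : Set E4) (K₁ K₂ : E4 → E4),
      MetricCoord.IsMetricOn G V → IsConnected V → IsOpen U → U ⊆ V → U.Nonempty →
      ContDiffOn ℝ 2 K₁ V → ContDiffOn ℝ 2 K₂ V →
      (∀ x ∈ V, ∀ Y Z : E4,
        fderiv ℝ G x (K₁ x) Y Z + G x (fderiv ℝ K₁ x Y) Z + G x Y (fderiv ℝ K₁ x Z) = 0) →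
      (∀ x ∈ V, ∀ Y Z : E4,
        fderiv ℝ G x (K₂ x) Y Z + G x (fderiv ℝ K₂ x Y) Z + G x Y (fderiv ℝ K₂ x Z) = 0) →
      (∀ x ∈ U, K₁ x = K₂ x) →
      ∀ x ∈ V, K₁ x = K₂ x :=
  Theorems.stub_killingPatching_of killingUniqueContinuation

/-- **Patching of MANIFOLD Killing fields through an immersed chart — PROVED (rev c8c/c9; the
node-facing form of `killingPatching` via the chart bridge (G5)).** Two `IsKillingFieldOn` fields
of `𝓢` on the image `Ψ '' W` of an immersed chart (`W` open connected) which agree on `Ψ '' U`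
(`U ⊆ W` nonempty open) agree on `Ψ '' W` (`Theorems.stub_isKillingFieldOn_patching`, p129404;
O'Neill 1983, Ch. 9, Lemma 9.27 read through the chart). -/
theorem isKillingFieldOn_patching :
    ∀ (𝓢 : Spacetime.{0} 4) [𝓢.metric.HasLeviCivita] (Ψ : E4 → 𝓢.carrier) (W U : Set E4)
      (K₁ K₂ : Π x : 𝓢.carrier, TangentSpace (𝓡 4) x),
      IsOpen W → IsConnected W → IsOpen U → U ⊆ W → U.Nonempty →
      ContMDiffOn 𝓘(ℝ, E4) (𝓡 4) ∞ Ψ W →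
      (∀ y ∈ W, Function.Injective (mfderiv 𝓘(ℝ, E4) (𝓡 4) Ψ y)) →
      𝓢.metric.toPseudoRiemannianMetric.IsKillingFieldOn K₁ (Ψ '' W) →
      𝓢.metric.toPseudoRiemannianMetric.IsKillingFieldOn K₂ (Ψ '' W) →
      (∀ y ∈ U, K₁ (Ψ y) = K₂ (Ψ y)) →
      ∀ y ∈ W, K₁ (Ψ y) = K₂ (Ψ y) :=
  Theorems.stub_isKillingFieldOn_patching

/-! ## §1f  ESCAPE: the band `{r ≥ r₊ + η}` lies in `I⁻` of the far zone, orientation-free — PROVED (rev c9)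

The node phrases its causal sets through `docOf = I⁻(far zone)` and `belowZone ρ = Ψ({r < ρ}) ∩
docOf`; the sweeps need these to be honest chart sublevel regions of `r`. They are: -/

/-- **Localisation of the domain of outer communications in a near-Kerr chart, orientation-free
— PROVED (rev c9).** For `0 < M`, `|a| < M`, `0 < η`, `r₊ + η ≤ R` there is `δ > 0` such that for
every spacetime `𝓢` and every chart `Φ : E4 → 𝓢` smooth with injective differential on `{r > M}`
and `δ`-close to the Kerr–Schild form in `C⁰` and `C¹` on `r₊ + η/2 ≤ r ≤ R + 2`, every point
`z` with `r₊ + η ≤ r(z) ≤ R` satisfies `Φ z ∈ I⁻(Φ({r > R}))`, for the time orientation of `𝓢`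
WHICHEVER of the two classes it induces on the chart (two exact-Kerr escape fields in opposite
cones, uniformly controlled straight chart segments, transitivity of `≪`;
`Theorems.stub_docLocalisation`). Hence `docOf ⊇ Ψ({r₊ + η ≤ r})` and
`belowZone ρ ⊇ Ψ({r₊ + η ≤ r < ρ})` for the eternal star chart of the node (read as a total map by
`Theorems.stub_starChartExtension`, immersion by `Theorems.stub_injective_mfderiv_of_close`).
O'Neill 1983, Ch. 14; Dafermos–Rodnianski arXiv:0811.0354, §5.1. -/
theorem docLocalisation :
    ∀ (M a η R : ℝ), 0 < M → |a| < M → 0 < η → Kerr.rPlus M a + η ≤ R →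
      ∃ δ : ℝ, 0 < δ ∧
      ∀ (𝓢 : Spacetime.{0} 4) (Φ : E4 → 𝓢.carrier),
        ContMDiffOn 𝓘(ℝ, E4) (𝓡 4) ∞ Φ {z | M < Kerr.radius a z} →
        (∀ z : E4, M < Kerr.radius a z → Function.Injective (mfderiv 𝓘(ℝ, E4) (𝓡 4) Φ z)) →
        (∀ z : E4, Kerr.rPlus M a + η / 2 ≤ Kerr.radius a z → Kerr.radius a z ≤ R + 2 →
          ‖𝓢.metricInCoords Φ z - Kerr.bilin M a z‖ ≤ δ ∧
          ‖fderiv ℝ (𝓢.metricInCoords Φ) z - fderiv ℝ (Kerr.bilin M a) z‖ ≤ δ) →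
        ∀ z : E4, Kerr.rPlus M a + η ≤ Kerr.radius a z → Kerr.radius a z ≤ R →
          Φ z ∈ 𝓢.metric.chronologicalPast 𝓢.timeOrientation (Φ '' {y | R < Kerr.radius a y}) :=
  Theorems.stub_docLocalisation

/-! ## §1g  SWEEP: globalisation of a uniform local extension property across the cylinders — PROVED (rev c9)

The three sweeps S3/S5/S6b share one topological argument — local extensions with a uniform radius
across the level cylinders `{r = c}`, patched by unique continuation (§1e), exhaust the swept band.
It is now a theorem, in abstract form and for coordinate Killing fields of a metric datum: -/

/-- **The abstract level-set sweep — PROVED (rev c9).** For a predicate `P k U` on fields and sets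
which restricts, is local, glues over open families and has unique continuation on connected
opens; a continuous `f` with convex `{f ≤ c}`, `{f ≤ c} ⊆ closure {f < c}` and a linear covering
estimate on `[c₀, c₁]`; an open arena `D` containing the `ρ`-balls around the level points; and
the UNIFORM LOCAL EXTENSION property across every level `c ∈ [c₀, c₁]` (input radius `ρ`, output
radius `ρ'`): every `P`-field on `D ∩ {f < c₀}` extends to a `P`-field on `D ∩ {f < c₁}`
(`Theorems.stub_levelSweep`, p130539; the Kerr-radius geometry is `Theorems.stub_kerrRadius_sublevel_convex`
/ `Theorems.stub_kerrRadius_bandCover`). [folklore globalisation; cf. Alexakis–Ionescu–Klainerman, CMP 299 (2010), §6] -/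
theorem levelSweep :
    ∀ (β : Type) (P : (E4 → β) → Set E4 → Prop) (f : E4 → ℝ) (D : Set E4) (c₀ c₁ ρ ρ' C : ℝ)
      (k₀ : E4 → β),
      (∀ (k : E4 → β) (U V : Set E4), P k U → V ⊆ U → P k V) →
      (∀ (k k' : E4 → β) (U : Set E4), IsOpen U → EqOn k k' U → P k U → P k' U) →
      (∀ (k : E4 → β) (ι : Type) (U : ι → Set E4), (∀ i, IsOpen (U i)) →
        (∀ i, P k (U i)) → P k (⋃ i, U i)) →
      (∀ (k₁ k₂ : E4 → β) (U V : Set E4), IsOpen V → IsConnected V → IsOpen U → U ⊆ V →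
        U.Nonempty → P k₁ V → P k₂ V → EqOn k₁ k₂ U → EqOn k₁ k₂ V) →
      Continuous f → IsOpen D → c₀ ≤ c₁ → 0 < ρ' → 0 < C →
      (∀ c ∈ Icc c₀ c₁, Convex ℝ {x | f x ≤ c}) →
      (∀ c ∈ Icc c₀ c₁, {x | f x ≤ c} ⊆ closure {x | f x < c}) →
      (∀ c ∈ Icc c₀ c₁, ∀ y ∈ D, c ≤ f y → ∃ x, f x = c ∧ ‖x - y‖ ≤ C * (f y - c)) →
      (∀ c ∈ Icc c₀ c₁, ∀ x, f x = c → Metric.ball x ρ ⊆ D) →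
      (∀ c ∈ Icc c₀ c₁, ∀ x, f x = c → ∀ k : E4 → β, P k (Metric.ball x ρ ∩ {y | f y < c}) →
        ∃ k' : E4 → β, P k' (Metric.ball x ρ') ∧ EqOn k' k (Metric.ball x ρ' ∩ {y | f y < c})) →
      P k₀ (D ∩ {y | f y < c₀}) →
      ∃ k : E4 → β, P k (D ∩ {y | f y < c₁}) ∧ EqOn k k₀ (D ∩ {y | f y < c₀}) :=
  Theorems.stub_levelSweep

/-- **The sweep for coordinate Killing fields across the Kerr–Schild cylinders — PROVED (rev c9).**
For a metric datum `G` on `W` (`IsMetricOn`), an open arena `D ⊆ W` containing the `ρ`-balls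
around the cylinders `{r = c}`, `c ∈ [c₀, c₁]` (`0 < c₀`, `|a| ≤ c₀`), and the uniform local
Killing-extension property across every such cylinder: a `C²` solution of the coordinate Killing
equation on `D ∩ {r < c₀}` extends to one on `D ∩ {r < c₁}` (`Theorems.stub_kerrCoordKillingSweep`:
`levelSweep` with `P k U :=` "`k` is `C²`-Killing on an open superset of `U` inside `W`", axioms
from §1e); its `C^∞` twin — the regularity the node's `IsKillingFieldOn` sections require, and
the one IK's theorem delivers — is `Theorems.stub_kerrCoordKillingSweepSmooth` (p131650, same proof
at order `∞`). What S5/S6b still take from the literature is exactly the local extension hypothesis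
(IK JAMS 26 (2013) Thm 1.2 / Surveys 20 (2015) Thm 2.4 in chart form). -/
theorem kerrCoordKillingSweep :
    ∀ (G : E4 → E4 →L[ℝ] E4 →L[ℝ] ℝ) (W D : Set E4) (a c₀ c₁ ρ ρ' : ℝ) (k₀ : E4 → E4),
      MetricCoord.IsMetricOn G W → IsOpen D → D ⊆ W → c₀ ≤ c₁ → 0 < c₀ → |a| ≤ c₀ → 0 < ρ' → 0 < ρ →
      (∀ c ∈ Icc c₀ c₁, ∀ x : E4, Kerr.radius a x = c → Metric.ball x ρ ⊆ D) →
      (∀ c ∈ Icc c₀ c₁, ∀ x : E4, Kerr.radius a x = c → ∀ k : E4 → E4,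
        ContDiffOn ℝ 2 k (Metric.ball x ρ ∩ {y | Kerr.radius a y < c}) →
        (∀ y ∈ Metric.ball x ρ ∩ {y | Kerr.radius a y < c}, ∀ Y Z : E4,
          fderiv ℝ G y (k y) Y Z + G y (fderiv ℝ k y Y) Z + G y Y (fderiv ℝ k y Z) = 0) →
        ∃ k' : E4 → E4, ContDiffOn ℝ 2 k' (Metric.ball x ρ') ∧
          (∀ y ∈ Metric.ball x ρ', ∀ Y Z : E4,
            fderiv ℝ G y (k' y) Y Z + G y (fderiv ℝ k' y Y) Z + G y Y (fderiv ℝ k' y Z) = 0) ∧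
          EqOn k' k (Metric.ball x ρ' ∩ {y | Kerr.radius a y < c})) →
      ContDiffOn ℝ 2 k₀ (D ∩ {y | Kerr.radius a y < c₀}) →
      (∀ y ∈ D ∩ {y | Kerr.radius a y < c₀}, ∀ Y Z : E4,
        fderiv ℝ G y (k₀ y) Y Z + G y (fderiv ℝ k₀ y Y) Z + G y Y (fderiv ℝ k₀ y Z) = 0) →
      ∃ k : E4 → E4, ContDiffOn ℝ 2 k (D ∩ {y | Kerr.radius a y < c₁}) ∧
        (∀ y ∈ D ∩ {y | Kerr.radius a y < c₁}, ∀ Y Z : E4,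
          fderiv ℝ G y (k y) Y Z + G y (fderiv ℝ k y Y) Z + G y Y (fderiv ℝ k y Z) = 0) ∧
        EqOn k k₀ (D ∩ {y | Kerr.radius a y < c₀}) :=
  Theorems.stub_kerrCoordKillingSweep

/-- **F1′ — the LOCAL Killing-extension theorem of Ionescu–Klainerman in chart form, with its
printed uniformity (the one remaining literature input of the sweeps S5/S3; rev c9 types it, no
claim of proof).** Ionescu–Klainerman, *On the local extension of Killing vector-fields in
Ricci flat manifolds*, JAMS 26 (2013), arXiv:1108.3575: THEOREM 1.2 (p. 3) — `(M, g)` smooth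
Ricci flat pseudo-Riemannian, `O ⊆ M` strongly pseudo-convex at `p ∈ ∂O` (Def. 1.1: a defining
function `f` on a neighbourhood `U`, `∇f(p) ≠ 0`, `O ∩ U = {f < 0}`, `D²f(X,X)(p) < 0` for
`X ≠ 0` with `X(f)(p) = 0 = g_p(X,X)`), `Z` a smooth Killing field in `O` ⇒ `Z` extends as a
Killing field to a neighbourhood of `p`; and the REMARK after it together with §2.2 (p. 8,
(quant2), Lemma 2.10, Lemma 2.11): in coordinates `Φᵖ : B₁ → B₁(p)` with `g_{αβ}(p) =
diag(−1, 1, 1, 1)` and `sup_{B₁(p)} Σ_{j=1}^{6} |∂ʲg| + Σ_{j=1}^{4} |∂ʲf| ≤ A`, and with the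
quantitative pseudo-convexity (quant6) `|∂¹f(p)| ≥ A₁⁻¹`,
`XᵅXᵝ(μ g_{αβ}(p) − D_αD_βf(p)) + A₁|X(f)(p)|² ≥ A₁⁻¹|X|²` for some `μ ∈ [−A₁, A₁]`, `A₁ ≥ A`,
the vanishing (hence the extension) holds on `B_{δ₁}(p)` for data given on `B_{δ₀}(p) ∩ O`,
where "`δ₁ > 0` depends only on `A`, `δ₀` and `A₁`" and "does not depend in any way on the
vector-field `Z` itself". Rendered here for `d = 4`, Lorentzian signature, over a metric datum
`G` on the unit ball of `E4` (`MetricCoord.IsMetricOn`, coordinate Ricci `MetricCoord.ricAt`,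
coordinate Hessian `MetricCoord.hessAt`), with Mathlib operator norms of `iteratedFDeriv` in
place of the component sums `|∂ʲ·|` (equivalent up to a dimensional constant absorbed in the
universally quantified `A`), the Killing equation in its coordinate form
`DG(K)(Y,Z) + G(DK Y, Z) + G(Y, DK Z) = 0` (§1e), and `C^∞` for "smooth".
-- TODO(general form): all dimensions and signatures; IK's component-sum norms.
rev c10c: this is now the Literature NAMED FACT
`Literature.Geometry.Lorentzian.IonescuKlainermanLocalExtension`
(`Literature/Geometry/Lorentzian/KillingFieldLocalExtension.lean`, p136449; same body), kept
under the old name for the files that consume it by δ-unfolding; it is exactly the local input of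
`kerrCoordKillingSweep`, whose `hloc` it discharges on every Kerr band via §1d
(`kerrMultiplierBelowShellKS` / `kerrMultiplierBeyondShellKS` = (quant6)) after normalising the
chart at the point (`Theorems.stub_ikLocalStep` / `…Out`). [cite: IonescuKlainerman2013, Thm 1.2, Lemma 2.10, Lemma 2.11] -/
def IKLocalKillingExtension : Prop :=
  IonescuKlainermanLocalExtension

/-! ## §2  The node: eternal, doubly silent, near-Kerr vacuum spacetimes are Kerr

(rev c13: `starBG`, `farZone`, `docOf`, `horizonOf`, `belowZone`, `docOfChart`, `FarSilentNearKerr`,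
`HorizonSilent`, `SilentEternalNearKerr` (+ `.mono`), `IsExactKerrOnExterior`, `TimelikeKillingBeyond`,
`HawkingPair`, `GlobalKillingPair`, `belowZone_mono` are the landed `Theorems.PhotonShellNode.*` — docstrings there.) -/


/-- **NODE AUDIT (rev c9): the empty-horizon junk channel, kernel-checked.** If the charted
horizon `horizonOf = frontier docOf ∩ range Ψ` is EMPTY (a2's visibility channel: the deep
interior of the chart visible from the far zone through `𝓢 ∖ range Ψ`, e.g. a periodically
identified maximal Kerr chain), then `GlobalKillingPair` holds as soon as SOME field `T` is Killing
on `docOf` and timelike beyond some radius — with the "Hawking pair" `(K, V) := (T, ∅)`: every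
horizon clause is a `∀ p ∈ ∅`. So on that channel S6/S6b/S7 transmit no horizon information; the
re-typed node should exclude it (no-visibility clause, or global hyperbolicity of `𝓢`).
[folklore] -/
theorem globalKillingPair_of_horizonOf_eq_empty (𝓢 : Spacetime.{0} 4) [𝓢.metric.HasLeviCivita]
    (M a : ℝ) (Ψ : (starBG M a).domain → 𝓢.carrier) (h : horizonOf 𝓢 M a Ψ = ∅)
    (T : Π x : 𝓢.carrier, TangentSpace (𝓡 4) x) (R : ℝ)
    (hT : 𝓢.metric.toPseudoRiemannianMetric.IsKillingFieldOn T (docOf 𝓢 M a Ψ))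
    (hTR : TimelikeKillingBeyond 𝓢 M a Ψ T R) : GlobalKillingPair 𝓢 M a Ψ := by
  refine ⟨T, T, ∅, R, ⟨isOpen_empty, by rw [h], ?_, fun p hp ↦ ?_⟩,
    by rw [union_empty]; exact hT.mono inter_subset_left,
    by rw [union_empty]; exact hT.mono inter_subset_left, hTR⟩
  · exact ⟨contMDiffOn_empty, fun x hx ↦ hx.elim⟩
  · rw [h] at hp
    exact hp.elim

-- (rev c13) the §1f node consequences `farSilent_band_subset_docOf_of/…docOf/…belowZone/…docOfU/…belowZoneU`
-- are the landed `Theorems.PhotonShellNode.*` (`…NodeChartPackage.lean`, p158619).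

/-- **THE NODE — local rigidity of sub-extremal Kerr among eternal doubly silent vacuum
spacetimes.** For every margin `χ < 1`, surface-gravity floor `κ₀ > 0` and mass window `m₀` there
are an order `k` and a tolerance `δ > 0` such that every Ricci-flat spacetime carrying an eternal
rest-frame Kerr-star chart of a label `(M, a)` in the window (`m₀ ≤ M ≤ m₀⁻¹`, `|a| ≤ χM`) which is
`δ`-silent-near-Kerr at order `k` (`SilentEternalNearKerr`: weighted time-uniform `Cᵏ` nearness
= no news at either end, non-expanding horizon with `κ ≥ κ₀`) is exactly Kerr on the closed
domain of outer communications of the charted region (`IsExactKerrOnExterior`; rev a2 — the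
interior strip `{M < r < r₊}` is NOT rigid, §0).
The Liouville theorem an `ω`-limit proof of the restated crux's clause (iii) consumes; its linear
pilot is "an eternal, `t*`-bounded, horizon-regular solution of the Teukolsky/wave system on
sub-extremal Kerr with zero flux through `𝓗⁺` and `𝓘⁺` for all times vanishes/is stationary"
(card, falsifier (ii); triage r1-2/r1-3: holds mode by mode). No Kerr-stability theorem at any
`|a|` is invoked. -/
def EternalSilentNearKerrIsKerr : Prop :=
  ∀ (χ κ₀ m₀ : ℝ), χ < 1 → 0 < κ₀ → 0 < m₀ → ∃ (k : ℕ) (δ : ℝ), 0 < δ ∧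
    ∀ (𝓢 : Spacetime.{0} 4) [𝓢.metric.HasLeviCivita] (M a : ℝ)
      (Ψ : (starBG M a).domain → 𝓢.carrier) (t : 𝓢.carrier → ℝ),
      m₀ ≤ M → M ≤ m₀⁻¹ → |a| ≤ χ * M →
      SilentEternalNearKerr 𝓢 M a Ψ k δ κ₀ t → IsExactKerrOnExterior 𝓢 M a Ψ

/-! ## §3  The six analytic stubs and the composition -/

/-- Statement of `stub_scriIgnition` (S2). rev c11 RESHAPE: the start radius `R` of the far zone
on which the scri-side Killing field is produced is bounded by a LABEL-LEVEL `R₀`, chosen with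
`(k, δ)` before the spacetime (the audit point of rev c10c on the S2/S3 interface; under the
time-uniform weighted closeness the far zone `{r > R₀}` on which `T ≈ ∂_{t*}` is timelike is fixed
by the window alone). -/
def StubScriIgnition : Prop :=
  ∀ (χ κ₀ m₀ : ℝ), χ < 1 → 0 < κ₀ → 0 < m₀ → ∃ (k : ℕ) (δ R₀ : ℝ), 0 < δ ∧
    ∀ (𝓢 : Spacetime.{0} 4) [𝓢.metric.HasLeviCivita] (M a : ℝ)
      (Ψ : (starBG M a).domain → 𝓢.carrier) (t : 𝓢.carrier → ℝ),
      m₀ ≤ M → M ≤ m₀⁻¹ → |a| ≤ χ * M →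
      SilentEternalNearKerr 𝓢 M a Ψ k δ κ₀ t →
      ∃ (R : ℝ) (T : Π x : 𝓢.carrier, TangentSpace (𝓡 4) x), R ≤ R₀ ∧ TimelikeKillingBeyond 𝓢 M a Ψ T R

/-- **Stub 2 (S2) — SCRI IGNITION.** An eternal Ricci-flat spacetime that is weighted-`C²`-close
to Kerr uniformly in time — hence asymptotically flat with NO radiation field towards either end of
its null infinity at any retarded/advanced time — carries a Killing field `T`, timelike on a far
zone `{r > R}`. Alexakis–Schlue (arXiv:1504.04592, Thms 1.2–1.3: time-PERIODIC non-radiating vacuum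
⇒ stationary near spatial infinity, via the unique continuation from infinity of
Alexakis–Schlue–Shao arXiv:1312.1989, pseudo-convexity of large spheres from positivity of mass)
with eternity + two-sided time-uniform bounds replacing periodicity (the linear-in-`u` drifts of
§3.1 ibid. are killed by boundedness on `ℝ_u`) and weighted uniform decay at order `2` replacing
the smooth expansions at `𝓘±` (barrier `NonSmoothNullInfinity` conceded: the bet is that the
weighted clause, being what an extraction along far-regular data delivers, suffices for the
Carleman argument, whose weights live at finite large `r`). Only the far clause of the bundle is
used. Size L–XL. -/
theorem stub_scriIgnition : StubScriIgnition := by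
  sorry

/-- Statement of `stub_inwardSweep` (S3). rev c11 RESHAPE: the start radius is bounded by a
label-level `R₀` (supplied by the reshaped S2), quantified BEFORE `∃ k δ`; with it S3 is a
THEOREM modulo `IKLocalKillingExtension` (`inwardSweep_of_IK`, §3c). -/
def StubInwardSweep : Prop :=
  ∀ (χ κ₀ m₀ ε R₀ : ℝ), χ < 1 → 0 < κ₀ → 0 < m₀ → 0 < ε → ∃ (k : ℕ) (δ : ℝ), 0 < δ ∧
    ∀ (𝓢 : Spacetime.{0} 4) [𝓢.metric.HasLeviCivita] (M a : ℝ)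
      (Ψ : (starBG M a).domain → 𝓢.carrier) (t : 𝓢.carrier → ℝ),
      m₀ ≤ M → M ≤ m₀⁻¹ → |a| ≤ χ * M →
      SilentEternalNearKerr 𝓢 M a Ψ k δ κ₀ t →
      PericentresBeyond M a (rPhMinus M a) →
      ∀ (R : ℝ) (T : Π x : 𝓢.carrier, TangentSpace (𝓡 4) x), R ≤ R₀ →
        TimelikeKillingBeyond 𝓢 M a Ψ T R →
      ∃ (T' : Π x : 𝓢.carrier, TangentSpace (𝓡 4) x) (R' : ℝ),
        𝓢.metric.toPseudoRiemannianMetric.IsKillingFieldOn T' (farZone 𝓢 M a Ψ (rPhMinus M a + ε)) ∧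
        TimelikeKillingBeyond 𝓢 M a Ψ T' R'

/- (rev c11) `stub_inwardSweep` is now a THEOREM modulo the named fact — see §3c below:
**Stub 3 (S3) — INWARD SWEEP to the outer face of the photon shell. rev c10c: PROVED AT EACH LABEL
and up to a label-level start radius from `IKLocalKillingExtension` (`inwardSweepAtUpTo_of_IK`,
§3c); what is left of S3 itself is a label-level far radius (or a scale-covariant far sweep) and
the label-uniformity of the constants.** Given the pericentre
property of exact Kerr beyond `r_ph⁻(M,a)` (Stub 1) and a Killing field timelike on a far zone
(Stub 2), the Killing field extends across every level set `{r = c}`, `c` from `R` down to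
`r_ph⁻ + ε`: each leaf is strongly pseudo-convex for its outer side in exact Kerr (Stub 1 ⇒ a
positive quantitative margin on the compact-mod-scaling set of admissible tangencies with
`c ∈ [r_ph⁻ + ε, R + 1]`), pseudo-convexity is open under `C²`-perturbation of the metric
(`δ = δ(ε, χ, m₀)`; the weight `r^{j+1}` makes the far leaves uniform), and Ionescu–Klainerman's
extension theorem (arXiv:1108.3575, Thm 1.2; neighbourhood size controlled by the quantitative
constants, remark after Thm 1.2) is iterated leaf by leaf, uniformly in `t*` by the eternal
bounds; the extended field stays Killing and agrees with `T` far out (so remains timelike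
there). Honours barrier `IonescuKlainermanNonExtension`: only the THEOREM half (Thm 1.2) is used,
no horizon point is crossed. The sweep must stop at `r_ph⁻`: `Kerr.exists_trappedNullGeodesic`.
Size L.
Now: `theorem stub_inwardSweep (hIK : IKLocalKillingExtension) : StubInwardSweep` (§3c). -/

/-- Statement of `stub_horizonIgnition` (S4). -/
def StubHorizonIgnition : Prop :=
  ∀ (χ κ₀ m₀ : ℝ), χ < 1 → 0 < κ₀ → 0 < m₀ → ∃ (k : ℕ) (δ η₄ : ℝ), 0 < δ ∧ 0 < η₄ ∧
    ∀ (𝓢 : Spacetime.{0} 4) [𝓢.metric.HasLeviCivita] (M a : ℝ)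
      (Ψ : (starBG M a).domain → 𝓢.carrier) (t : 𝓢.carrier → ℝ),
      m₀ ≤ M → M ≤ m₀⁻¹ → |a| ≤ χ * M →
      SilentEternalNearKerr 𝓢 M a Ψ k δ κ₀ t →
      ∃ (V : Set 𝓢.carrier) (K : Π x : 𝓢.carrier, TangentSpace (𝓡 4) x),
        HawkingPair 𝓢 M a Ψ K V ∧
        𝓢.metric.toPseudoRiemannianMetric.IsKillingFieldOn K
          (V ∪ belowZone 𝓢 M a Ψ (Kerr.rPlus M a + η₄))

/-- **Stub 4 (S4) — HORIZON IGNITION, rev c9c RESHAPE: the Hawking field is handed over on a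
UNIFORM ONE-SIDED COLLAR of the horizon in the d.o.c.** (`K` Killing on
`V ∪ belowZone (r₊ + η₄)` for some `η₄(χ, κ₀, m₀) > 0` fixed before `𝓢` — what a bifurcate-sphere /
red-shift normal form with the eternal uniform bounds actually produces, and what the outward
sweep S5 needs to start from; the rev ≤ c9b form `∃ V K, HawkingPair K V` gave `V ⊇ horizonOf` of
no uniform thickness along the non-compact horizon, from which no cylinder can be swept — lead c9
node audit (ii).) Original description (the card's hardest own stub; = triage's B1′ of card
`eternal-redshift-rigidity`, WITH non-expansion and two-sided control).** An eternal, horizon-regular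
(the chart is horizon-penetrating and `δ`-close to Kerr-star in `Cᵏ` across `𝓗`), Ricci-flat
spacetime whose event horizon is non-expanding for all times with surface gravity `≥ κ₀ > 0` in
the Kerr-star clock carries a HAWKING Killing field `K` on a two-sided open neighbourhood `V` of
`𝓗`, non-zero and null (hence tangent to the generators) on `𝓗`. Intended proof: the red-shift
normal form along an eternal NEH with `κ ≥ κ₀` attaches a regular bifurcation sphere at
`t* = −∞` (Rácz–Wald, CQG 9 (1992) 2643 and CQG 13 (1996) 539, for Killing horizons; here the
eternal two-sided `Cᵏ` bounds make the Kruskal-type extension `C^{k−1}`), and the UNCONDITIONAL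
bifurcate-NEH rigidity of Alexakis–Ionescu–Klainerman (GAFA 20 (2010), arXiv:0902.1173, Thm 1.1)
gives `K` near the sphere, transported along `𝓗` by the eternal structure; alternatively
Petersen–Rácz-type unique continuation (arXiv:1903.09135 Thm 1.4, arXiv:1809.02580 Thm 1.2) with
two-sided boundedness in place of compactness (frozen transversal jets by the blue-shift
`e^{−jκv}` towards `v → −∞`, card `eternal-redshift-rigidity` B0). Evades barrier
`IonescuKlainermanNonExtension` by hypothesis class (evasions (2)/(3) of its audited block: a
bifurcation sphere / a whole horizon of constant-sign `κ`, never one-sided local data at one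
horizon point). `ExtremalHorizonInstability` (Aretakis) is why `κ₀ > 0` is load-bearing. Linear
pilot (triage r1-3): `C¹`-regularity across `𝓗⁺` kills the branch `e^{−iωv}(r − r₊)^{iω/κ}`, zero
flux forces the regular branch to vanish unless `ω = mΩ_H`. Size XL (new theorem). -/
theorem stub_horizonIgnition : StubHorizonIgnition := by
  sorry

/-- Statement of `stub_outwardSweep` (S5). -/
def StubOutwardSweep : Prop :=
  ∀ (χ κ₀ m₀ ε η₄ : ℝ), χ < 1 → 0 < κ₀ → 0 < m₀ → 0 < ε → 0 < η₄ → ∃ (k : ℕ) (δ : ℝ), 0 < δ ∧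
    ∀ (𝓢 : Spacetime.{0} 4) [𝓢.metric.HasLeviCivita] (M a : ℝ)
      (Ψ : (starBG M a).domain → 𝓢.carrier) (t : 𝓢.carrier → ℝ),
      m₀ ≤ M → M ≤ m₀⁻¹ → |a| ≤ χ * M →
      SilentEternalNearKerr 𝓢 M a Ψ k δ κ₀ t →
      Kerr.rPlus M a + 2 * ε ≤ rPhPlus M a → ApocentresBelow M a (rPhPlus M a) →
      ∀ (V : Set 𝓢.carrier) (K : Π x : 𝓢.carrier, TangentSpace (𝓡 4) x), HawkingPair 𝓢 M a Ψ K V →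
      𝓢.metric.toPseudoRiemannianMetric.IsKillingFieldOn K
          (V ∪ belowZone 𝓢 M a Ψ (Kerr.rPlus M a + η₄)) →
      ∃ (K' : Π x : 𝓢.carrier, TangentSpace (𝓡 4) x) (V' : Set 𝓢.carrier),
        HawkingPair 𝓢 M a Ψ K' V' ∧
        𝓢.metric.toPseudoRiemannianMetric.IsKillingFieldOn K' (V' ∪ belowZone 𝓢 M a Ψ (rPhPlus M a - ε))

/- (rev c11) `stub_outwardSweep` is now a THEOREM modulo the named fact — see §3d below:
**Stub 5 (S5) — OUTWARD SWEEP to the inner face of the photon shell. rev c10: PROVED AT EACH LABEL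
from `IKLocalKillingExtension` (`outwardSweepAt_of_IK`, §3b); what is left of S5 itself is the
label-uniformity of the constants. rev c9c RESHAPE: the sweep
STARTS from the uniform collar `belowZone (r₊ + η₄)` on which S4 hands over the Hawking field
(hypothesis `IsKillingFieldOn K (V ∪ belowZone (r₊ + η₄))`, any `η₄ > 0`, `δ = δ(…, η₄)`).** With
§1f (`farSilent_band_subset_belowZone`: for `δ` small the collar contains the chart band
`{r₊ + η₄ ≤ r < c}` at every time) and §1g (`kerrCoordKillingSweep[Smooth]`: sweep through the
cylinders `{r = c}`, `c` from `r₊ + η₄` to `r_ph⁺ − ε`, in the arena `{r > r₊ + η₄/2}`), this stub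
is EXACTLY `IKLocalKillingExtension` (§1g) + the chart normalisation at the point + the pushforward
glue (converse of G5). Original description: given the apocentre
property of exact Kerr on `(r₊, r_ph⁺(M,a))` (Stub 1) and a Hawking pair `(K, V)` (Stub 4), `K`
extends as a Killing field from `V` outward across the level sets `{r = c}`,
`r₊ + (thickness of V) ≤ c ≤ r_ph⁺ − ε`, to `V' ∪ (Ψ({r < r_ph⁺ − ε}) ∩ d.o.c.)`: each leaf is
strongly pseudo-convex for its INNER side in exact Kerr for tangencies of every Killing energy
(Stub 1, the ergoregion included; rev c6: PROVED geometrically at every point and in `C²`-stable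
form over `metricInCoords`, §1b `apocentresBelow_geometric` / `kerrCylindersBendInwardKS`), the
property is `C²`-open, the chart IS `δ`-close to Kerr on the collar, and Ionescu–Klainerman Thm 1.2 (arXiv:1108.3575) iterates uniformly in `t*`; the width
`ε` is prescribed (any `ε > 0` with `r₊ + 2ε ≤ r_ph⁺`, supplied uniformly on the window by Stub 1),
`δ = δ(ε)`. For `|a| ≤ M/√2` the swept zone contains the whole ergoregion top `r = 2M`. Honours
`IonescuKlainermanNonExtension` (only pseudo-convex leaves are crossed; the field being extended is
the Hawking field already given on BOTH sides of `𝓗`). Size L.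
Now: `theorem stub_outwardSweep (hIK : IKLocalKillingExtension) : StubOutwardSweep` (§3d). -/

/-- Statement of `stub_beltBridge` (S6). rev c13 RESHAPE: the label gap `r₊ + 2ε ≤ r_ph⁺` of S1
(available in the composition, needed by the conditional sweep S6b to start off the horizon) is
now an explicit hypothesis, as in S5. -/
def StubBeltBridge : Prop :=
  ∀ (χ κ₀ m₀ ε : ℝ), χ < 1 → 0 < κ₀ → 0 < m₀ → 0 < ε → ∃ (k : ℕ) (δ : ℝ), 0 < δ ∧
    ∀ (𝓢 : Spacetime.{0} 4) [𝓢.metric.HasLeviCivita] (M a : ℝ)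
      (Ψ : (starBG M a).domain → 𝓢.carrier) (t : 𝓢.carrier → ℝ),
      m₀ ≤ M → M ≤ m₀⁻¹ → |a| ≤ χ * M →
      SilentEternalNearKerr 𝓢 M a Ψ k δ κ₀ t →
      Kerr.rPlus M a + 2 * ε ≤ rPhPlus M a →
      ∀ (T : Π x : 𝓢.carrier, TangentSpace (𝓡 4) x) (R : ℝ),
        𝓢.metric.toPseudoRiemannianMetric.IsKillingFieldOn T (farZone 𝓢 M a Ψ (rPhMinus M a + ε)) →
        TimelikeKillingBeyond 𝓢 M a Ψ T R →
      ∀ (K : Π x : 𝓢.carrier, TangentSpace (𝓡 4) x) (V : Set 𝓢.carrier),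
        HawkingPair 𝓢 M a Ψ K V →
        𝓢.metric.toPseudoRiemannianMetric.IsKillingFieldOn K (V ∪ belowZone 𝓢 M a Ψ (rPhPlus M a - ε)) →
      GlobalKillingPair 𝓢 M a Ψ

/- (rev c13) `stub_beltBridge` is now a THEOREM modulo S6a‴ and the named fact — see §3f:
**Stub 6 (S6) — THE BELT BRIDGE (shared hard node, here in its sharpest form).** An eternal,
`δ`-near-Kerr, Ricci-flat spacetime carrying a Killing field `T` on `{r > r_ph⁻ + ε}` (timelike far
out) and a Hawking Killing field `K` on a two-sided horizon neighbourhood `∪ {r < r_ph⁺ − ε}`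
carries both as Killing fields on the whole d.o.c.: the residual BELT
`{r_ph⁺ − ε ≤ r ≤ r_ph⁻ + ε}` (compact modulo `t*`-translation, containing the trapped set and —
for `|a| > M/√2` — an equatorial lens of the ergoregion) is crossed. This is the node that
barrier `TrappingDerivativeLoss` (Sbierski's Gaussian beams on the shell) says no Carleman /
observability estimate crosses for general data; the bets, in the order a prover should try
them: (a) time-analyticity first (route LeakageWritesInInk's `TimeAnalyticLiouville` engine:
with `T` flanking from outside, Tataru-type continuation needs pseudo-convexity only against
ZERO-`T`-ENERGY null geodesics, and near Kerr none is trapped in the belt away from the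
ergoregion), (b) the near-Kerr smallness `δ` (the belt metric is `Cᵏ`-close to Kerr, whose
Killing fields DO cross; a perturbative unique-continuation / Carleman argument with the Kerr
Carter structure, cf. AIK Duke 2014 Thm 1.1 for small `‖g(T,T)‖`), (c) route BeltLiouville's
`BeltKillingLiouville` once ONE of the two fields is global. Honest status: open; it is where
`IonescuKlainermanNonExtension`'s "global information is necessary" bites, and the global
information offered is exactly the two flanking fields + eternity. Size XL / open.
rev c7: S6 ⇐ S6a `StubBeltBridgeT` (carry `T` alone across the belt — the open node) + S6b
`StubConditionalExtensionK` (extend `K` given global `T` by the `T`-conditional sweep, whose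
hypersurface condition §1c is kernel-checked on every cylinder): `stub_beltBridge_of`.
Now: `theorem stub_beltBridge (hIKC : IKConditionalLocalKillingExtension) : StubBeltBridge` (§3f). -/

/-- Statement of S6a (rev c7) — **the belt FOR `T` ALONE**: under S6's hypotheses (a Killing
field `T` on `{r > r_ph⁻ + ε}`, timelike far out, and a Hawking Killing field on a two-sided horizon
neighbourhood `∪ {r < r_ph⁺ − ε}`), `T` extends to a Killing field on the whole d.o.c. `∪ V`,
still timelike beyond some radius. This is where `IonescuKlainermanNonExtension` /
`TrappingDerivativeLoss` bite (no Carleman estimate crosses the trapped belt for general data); the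
bets are S6's (a) time-analyticity with `K` flanking from inside, (b) near-Kerr smallness `δ` with
the Carter structure, (c) `BeltKillingLiouville`. Honest status: OPEN — the one node of the line
that is neither published nor kernel-checked. -/
def StubBeltBridgeT : Prop :=
  ∀ (χ κ₀ m₀ ε : ℝ), χ < 1 → 0 < κ₀ → 0 < m₀ → 0 < ε → ∃ (k : ℕ) (δ : ℝ), 0 < δ ∧
    ∀ (𝓢 : Spacetime.{0} 4) [𝓢.metric.HasLeviCivita] (M a : ℝ)
      (Ψ : (starBG M a).domain → 𝓢.carrier) (t : 𝓢.carrier → ℝ),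
      m₀ ≤ M → M ≤ m₀⁻¹ → |a| ≤ χ * M →
      SilentEternalNearKerr 𝓢 M a Ψ k δ κ₀ t →
      ∀ (T : Π x : 𝓢.carrier, TangentSpace (𝓡 4) x) (R : ℝ),
        𝓢.metric.toPseudoRiemannianMetric.IsKillingFieldOn T (farZone 𝓢 M a Ψ (rPhMinus M a + ε)) →
        TimelikeKillingBeyond 𝓢 M a Ψ T R →
      ∀ (K : Π x : 𝓢.carrier, TangentSpace (𝓡 4) x) (V : Set 𝓢.carrier),
        HawkingPair 𝓢 M a Ψ K V →
        𝓢.metric.toPseudoRiemannianMetric.IsKillingFieldOn K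
          (V ∪ belowZone 𝓢 M a Ψ (rPhPlus M a - ε)) →
      ∃ (T' : Π x : 𝓢.carrier, TangentSpace (𝓡 4) x) (R' : ℝ),
        𝓢.metric.toPseudoRiemannianMetric.IsKillingFieldOn T' (docOfChart 𝓢 M a Ψ ∪ V) ∧
        TimelikeKillingBeyond 𝓢 M a Ψ T' R'

/-- Statement of S6b (rev c7; rev c12: `docOfChart` in place of `docOf`) — **the `T`-conditional
extension of the Hawking field**: given a
Killing field `T` on the charted d.o.c. `∪ V` (timelike far out) and a Hawking Killing field `K` on
`V ∪ {r < r_ph⁺ − ε}`, `K` extends to the charted d.o.c. `∪ V` (so `(T, K)` is a `GlobalKillingPair`).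
Mechanism: the local extension principle for Killing fields across strictly `T`-null-convex
hypersurfaces — Ionescu–Klainerman, Surveys Diff. Geom. 20 (2015), Thm 2.4 (with Def. 2.2: the
defining function `h` is `T`-invariant and `D²h(X,X) < 0` on null `X` tangent to the level set and
orthogonal to `T`; hypotheses: `T` a nowhere-vanishing Killing field of the ambient region, the
field `Z` to be extended Killing on one side and COMMUTING with `T`; proof = the Carleman sweep of
the Killing extension system of IK, JAMS 26 (2013), with the `T`-conditional weights of IK,
Invent. Math. 175 (2009), §3) — swept outward through the cylinders `{r = c}`, `c > r₊`, exactly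
as Alexakis–Ionescu–Klainerman, CMP 299 (2010), §§5–6 extend the Hawking field across the whole
exterior of a stationary near-Kerr black hole. Its hypersurface condition on EVERY cylinder — the
belt included — is §1c (`kerrZeroEnergyBendInwardKS`, kernel-checked, stable in the `C¹`-jet of
`g` and in `T`; `T(r) = 0` in the `T`-adapted chart). The commutation `[T, K] = 0` demanded by
Thm 2.4 is NOT among the hypotheses below: the proof first replaces the given Hawking field by a
`T`-invariant one (re-ignition along the horizon with `T` now available on `V`, AIK GAFA 20 (2010)
Thm 1.1-type), which is why the conclusion only asks for SOME global pair. Published-theorem grade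
(formalisation XL); with `T` global, S5 is its special case. [cite: IonescuKlainerman2015, Thm 2.4] -/
def StubConditionalExtensionK : Prop :=
  ∀ (χ κ₀ m₀ ε : ℝ), χ < 1 → 0 < κ₀ → 0 < m₀ → 0 < ε → ∃ (k : ℕ) (δ : ℝ), 0 < δ ∧
    ∀ (𝓢 : Spacetime.{0} 4) [𝓢.metric.HasLeviCivita] (M a : ℝ)
      (Ψ : (starBG M a).domain → 𝓢.carrier) (t : 𝓢.carrier → ℝ),
      m₀ ≤ M → M ≤ m₀⁻¹ → |a| ≤ χ * M →
      SilentEternalNearKerr 𝓢 M a Ψ k δ κ₀ t →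
      ∀ (K : Π x : 𝓢.carrier, TangentSpace (𝓡 4) x) (V : Set 𝓢.carrier),
        HawkingPair 𝓢 M a Ψ K V →
        𝓢.metric.toPseudoRiemannianMetric.IsKillingFieldOn K
          (V ∪ belowZone 𝓢 M a Ψ (rPhPlus M a - ε)) →
      ∀ (T : Π x : 𝓢.carrier, TangentSpace (𝓡 4) x) (R : ℝ),
        𝓢.metric.toPseudoRiemannianMetric.IsKillingFieldOn T (docOfChart 𝓢 M a Ψ ∪ V) →
        TimelikeKillingBeyond 𝓢 M a Ψ T R →
      GlobalKillingPair 𝓢 M a Ψ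

/-- **S6 = S6a + S6b (rev c7, kernel-checked reduction; unchanged by the rev c12 reshape).** The belt bridge follows from the belt
for `T` alone and the `T`-conditional extension of `K`: take the larger order and the smaller
tolerance, carry `T` across (S6a), then extend `K` along the `T`-conditionally pseudo-convex
cylinders (S6b). [folklore] -/
theorem stub_beltBridge_of (hT : StubBeltBridgeT) (hK : StubConditionalExtensionK) :
    StubBeltBridge := by
  intro χ κ₀ m₀ ε hχ hκ₀ hm₀ hε
  obtain ⟨k₁, δ₁, hδ₁, H₁⟩ := hT χ κ₀ m₀ ε hχ hκ₀ hm₀ hε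
  obtain ⟨k₂, δ₂, hδ₂, H₂⟩ := hK χ κ₀ m₀ ε hχ hκ₀ hm₀ hε
  refine ⟨max k₁ k₂, min δ₁ δ₂, lt_min hδ₁ hδ₂, ?_⟩
  intro 𝓢 _ M a Ψ t hM hM' ha hS _ T R hTK hT' K V hKV hKK
  have hM0 : 0 ≤ M := (hm₀.trans_le hM).le
  have hS₁ : SilentEternalNearKerr 𝓢 M a Ψ k₁ δ₁ κ₀ t :=
    hS.mono (le_max_left _ _) (min_le_left _ _) hM0
  have hS₂ : SilentEternalNearKerr 𝓢 M a Ψ k₂ δ₂ κ₀ t :=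
    hS.mono (le_max_right _ _) (min_le_right _ _) hM0
  obtain ⟨T', R', hT'K, hT'R⟩ := H₁ 𝓢 M a Ψ t hM hM' ha hS₁ T R hTK hT' K V hKV hKK
  exact H₂ 𝓢 M a Ψ t hM hM' ha hS₂ K V hKV hKK T' R' hT'K hT'R

/-- Statement of `stub_perturbativeRigidity` (S7). -/
def StubPerturbativeRigidity : Prop :=
  ∀ (χ κ₀ m₀ : ℝ), χ < 1 → 0 < κ₀ → 0 < m₀ → ∃ (k : ℕ) (δ : ℝ), 0 < δ ∧
    ∀ (𝓢 : Spacetime.{0} 4) [𝓢.metric.HasLeviCivita] (M a : ℝ)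
      (Ψ : (starBG M a).domain → 𝓢.carrier) (t : 𝓢.carrier → ℝ),
      m₀ ≤ M → M ≤ m₀⁻¹ → |a| ≤ χ * M →
      SilentEternalNearKerr 𝓢 M a Ψ k δ κ₀ t →
      GlobalKillingPair 𝓢 M a Ψ → IsExactKerrOnExterior 𝓢 M a Ψ

/-- **Stub 7 (S7) — PERTURBATIVE RIGIDITY (known theorem, large formalisation; conclusion
repaired in rev a2).** A Ricci-flat spacetime `δ`-close to Kerr `(M, a)` on an eternal star chart,
stationary on its d.o.c. (global `T`, timelike far out) with a Hawking field `K` (global, null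
generator on the non-expanding horizon), is isometric ON THE CLOSED DOMAIN OF OUTER
COMMUNICATIONS of the charted region to an exact Kerr `(M', a')`: the smooth perturbative
black-hole uniqueness theorem of Alexakis–Ionescu–Klainerman (CMP 299 (2010) 89–127: stationary,
smooth, Mars–Simon-small ⇒ Kerr; smallness from `δ`; axisymmetry from the pair `T, K` via GAFA
2010 Thm 1.2 at the attached bifurcation sphere, or Chruściel–Costa 2008 Thm 1.3), the isometry
being two-sided near `𝓗` (Hawking pair on `V`) and extended into the interior strip as a mere
diffeomorphism (`IsExactKerrOnExterior`). The rev-1 text also claimed exact Kerr-ness of the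
interior strip `{M < r < r₊}` ("slaved to the horizon data by the blue-shift"); that is FALSE as a
rigidity statement (left-perturbed maximal Kerr, §0) and is not needed downstream. No open
no-hair theorem is used: nearness `δ` is available. Size XL (formalisation of a printed theorem). -/
theorem stub_perturbativeRigidity : StubPerturbativeRigidity := by
  sorry

/-- **COMPOSITION (sorry-free): the seven stub statements imply the node.** Take the shell width
`ε` of Stub 1, the six (order, tolerance) pairs at that `ε`, `k :=` their maximum and `δ :=` their
minimum (the bundle is monotone; rev c9c: the collar width `η₄` of (4) is fed to (5)); then: scri ignition (2) ⇒ inward sweep to `r_ph⁻ + ε` using the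
pericentre half of (1) ⇒ (3); horizon ignition (4) ⇒ outward sweep to `r_ph⁺ − ε` using the gap and
the apocentre half of (1) ⇒ (5); belt bridge (6) ⇒ global pair ⇒ exactly Kerr on the closed d.o.c. (7). [folklore] -/
theorem EternalSilentNearKerrIsKerr_of (h₁ : StubKerrShellTurning) (h₂ : StubScriIgnition)
    (h₃ : StubInwardSweep) (h₄ : StubHorizonIgnition) (h₅ : StubOutwardSweep)
    (h₆ : StubBeltBridge) (h₇ : StubPerturbativeRigidity) : EternalSilentNearKerrIsKerr := by
  intro χ κ₀ m₀ hχ hκ₀ hm₀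
  obtain ⟨ε, hε, H₁⟩ := h₁ χ m₀ hχ hm₀
  obtain ⟨k₂, δ₂, R₀, hδ₂, H₂⟩ := h₂ χ κ₀ m₀ hχ hκ₀ hm₀
  obtain ⟨k₃, δ₃, hδ₃, H₃⟩ := h₃ χ κ₀ m₀ ε R₀ hχ hκ₀ hm₀ hε
  obtain ⟨k₄, δ₄, η₄, hδ₄, hη₄, H₄⟩ := h₄ χ κ₀ m₀ hχ hκ₀ hm₀
  obtain ⟨k₅, δ₅, hδ₅, H₅⟩ := h₅ χ κ₀ m₀ ε η₄ hχ hκ₀ hm₀ hε hη₄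
  obtain ⟨k₆, δ₆, hδ₆, H₆⟩ := h₆ χ κ₀ m₀ ε hχ hκ₀ hm₀ hε
  obtain ⟨k₇, δ₇, hδ₇, H₇⟩ := h₇ χ κ₀ m₀ hχ hκ₀ hm₀
  refine ⟨max (max (max k₂ k₃) (max k₄ k₅)) (max k₆ k₇),
    min (min (min δ₂ δ₃) (min δ₄ δ₅)) (min δ₆ δ₇),
    lt_min (lt_min (lt_min hδ₂ hδ₃) (lt_min hδ₄ hδ₅)) (lt_min hδ₆ hδ₇), ?_⟩
  intro 𝓢 _ M a Ψ t hM hM' ha hS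
  have hMpos : 0 < M := hm₀.trans_le hM
  have hM0 : 0 ≤ M := hMpos.le
  have hS₂ : SilentEternalNearKerr 𝓢 M a Ψ k₂ δ₂ κ₀ t :=
    hS.mono ((le_max_left _ _).trans' ((le_max_left _ _).trans' (le_max_left _ _)))
      ((min_le_left _ _).trans ((min_le_left _ _).trans (min_le_left _ _))) hM0
  have hS₃ : SilentEternalNearKerr 𝓢 M a Ψ k₃ δ₃ κ₀ t :=
    hS.mono ((le_max_left _ _).trans' ((le_max_left _ _).trans' (le_max_right _ _)))
      ((min_le_left _ _).trans ((min_le_left _ _).trans (min_le_right _ _))) hM0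
  have hS₄ : SilentEternalNearKerr 𝓢 M a Ψ k₄ δ₄ κ₀ t :=
    hS.mono ((le_max_left _ _).trans' ((le_max_right _ _).trans' (le_max_left _ _)))
      ((min_le_left _ _).trans ((min_le_right _ _).trans (min_le_left _ _))) hM0
  have hS₅ : SilentEternalNearKerr 𝓢 M a Ψ k₅ δ₅ κ₀ t :=
    hS.mono ((le_max_left _ _).trans' ((le_max_right _ _).trans' (le_max_right _ _)))
      ((min_le_left _ _).trans ((min_le_right _ _).trans (min_le_right _ _))) hM0
  have hS₆ : SilentEternalNearKerr 𝓢 M a Ψ k₆ δ₆ κ₀ t :=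
    hS.mono ((le_max_right _ _).trans' (le_max_left _ _))
      ((min_le_right _ _).trans (min_le_left _ _)) hM0
  have hS₇ : SilentEternalNearKerr 𝓢 M a Ψ k₇ δ₇ κ₀ t :=
    hS.mono ((le_max_right _ _).trans' (le_max_right _ _))
      ((min_le_right _ _).trans (min_le_right _ _)) hM0
  obtain ⟨hgap, hP, hA⟩ := H₁ M a hM hM' ha
  obtain ⟨R, T, hRR₀, hT⟩ := H₂ 𝓢 M a Ψ t hM hM' ha hS₂
  obtain ⟨T', R', hT'K, hT'⟩ := H₃ 𝓢 M a Ψ t hM hM' ha hS₃ hP R T hRR₀ hT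
  obtain ⟨V, K, hK, hKcollar⟩ := H₄ 𝓢 M a Ψ t hM hM' ha hS₄
  obtain ⟨K', V', hK'V', hK'⟩ := H₅ 𝓢 M a Ψ t hM hM' ha hS₅ hgap hA V K hK hKcollar
  exact H₇ 𝓢 M a Ψ t hM hM' ha hS₇ (H₆ 𝓢 M a Ψ t hM hM' ha hS₆ hgap T' R' hT'K hT' K' V' hK'V' hK')

-- (rev c11) the node's one citable name `eternalSilentNearKerrIsKerr_of_IK` is at the end of the file (§3d).

/-! ## §3b  The outward sweep from `IKLocalKillingExtension`: per label (rev c10), label-uniform (rev c11, §3d)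

Lead c10 cashes the claim of rev c9c ("S5 is EXACTLY `IKLocalKillingExtension` + landed bricks +
the pushforward glue") in the kernel — at each label `(M, a)` of the window. Audit point recorded
with it: S5 (like every node stub) quantifies `∃ k δ` BEFORE the label, whereas every landed brick
is per-label (`∀ M a …, ∃ δ`); the uniformity of the constants over the compact label window
`[m₀, m₀⁻¹] × {|a| ≤ χM}` is a separate regularity statement about the Kerr family (exact scaling
in `M`; joint continuity in the spin on compact bands) which no brick supplies yet. Hence the
honest theorem is the per-label `StubOutwardSweepAt` below (`S5 ⇒ S5-at` trivially;
`S5-at + label-uniformity ⇒ S5` is the remaining gap), proved from `IKLocalKillingExtension` by: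
the chart package of the eternal star chart (rev c9 inline argument, here `farSilent_chartPackage`),
the d.o.c. localisation `farSilent_band_subset_belowZone` / `…_docOf` (§1f), the pulled-back
Hawking field as a coordinate Killing field (G5-A1/G5-A), the level-set sweep
`Theorems.stub_kerrCoordKillingSweepSmooth` (§1g) whose local step `hloc` is
`Theorems.stub_ikLocalStep` (N-6: IK at each cylinder point after the exact frame normalisation
N-6a, with IK's hypotheses N-6c and the Killing transport N-6d; bricks N-1 Lorentz normalisation,
N-2 all-order band bounds, N-3 affine covariance / iterated-derivative bounds, N-4 `ricAt` of a
Ricci-flat chart + locality of `IsKillingFieldOn`), the pushforward of the swept field to a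
manifold Killing field (N-5a/N-5b), and the Hawking-pair bookkeeping with the glued field
`K' := pushforward on Φ(W₁), K elsewhere` on the shrunk two-sided neighbourhood
`V' := V ∩ Φ({r < r₊ + 3η₄/4} ∪ {r > c₁ + ½})`. -/


/-- Statement of the PER-LABEL outward sweep (S5-at): S5 with the label `(M, a)` quantified
BEFORE `∃ k δ`. -/
def StubOutwardSweepAt : Prop :=
  ∀ (χ κ₀ m₀ ε η₄ M a : ℝ), χ < 1 → 0 < κ₀ → 0 < m₀ → 0 < ε → 0 < η₄ →
    m₀ ≤ M → M ≤ m₀⁻¹ → |a| ≤ χ * M → ∃ (k : ℕ) (δ : ℝ), 0 < δ ∧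
    ∀ (𝓢 : Spacetime.{0} 4) [𝓢.metric.HasLeviCivita]
      (Ψ : (starBG M a).domain → 𝓢.carrier) (t : 𝓢.carrier → ℝ),
      SilentEternalNearKerr 𝓢 M a Ψ k δ κ₀ t →
      Kerr.rPlus M a + 2 * ε ≤ rPhPlus M a → ApocentresBelow M a (rPhPlus M a) →
      ∀ (V : Set 𝓢.carrier) (K : Π x : 𝓢.carrier, TangentSpace (𝓡 4) x), HawkingPair 𝓢 M a Ψ K V →
      𝓢.metric.toPseudoRiemannianMetric.IsKillingFieldOn K
          (V ∪ belowZone 𝓢 M a Ψ (Kerr.rPlus M a + η₄)) →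
      ∃ (K' : Π x : 𝓢.carrier, TangentSpace (𝓡 4) x) (V' : Set 𝓢.carrier),
        HawkingPair 𝓢 M a Ψ K' V' ∧
        𝓢.metric.toPseudoRiemannianMetric.IsKillingFieldOn K' (V' ∪ belowZone 𝓢 M a Ψ (rPhPlus M a - ε))

/-- S5 implies S5-at (move the label inside). [folklore] -/
theorem stubOutwardSweepAt_of_stubOutwardSweep (h : StubOutwardSweep) : StubOutwardSweepAt := by
  intro χ κ₀ m₀ ε η₄ M a hχ hκ₀ hm₀ hε hη₄ hM hM' ha
  obtain ⟨k, δ, hδ, H⟩ := h χ κ₀ m₀ ε η₄ hχ hκ₀ hm₀ hε hη₄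
  exact ⟨k, δ, hδ, fun 𝓢 _ Ψ t hS ↦ H 𝓢 M a Ψ t hM hM' ha hS⟩


-- (rev c13) the chart package `farSilent_chartPackage_of/…/…U` is the landed `Theorems.PhotonShellNode.*` (p158619).

/-! ## §3d  The outward sweep S5 in full: label-UNIFORM constants (rev c11) -/

/-- **THE OUTWARD SWEEP S5 FROM IONESCU–KLAINERMAN (rev c11: label-UNIFORM; sorry-free modulo the
named fact `IKLocalKillingExtension`). rev c13: the proof is LANDED as
`Theorems.PhotonShellNode.outwardSweep_of_IK` (`…OutwardSweepOfIK.lean`, p160372; statement = the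
body of `StubOutwardSweep` verbatim, δ-unfolded here).** Assembly (see the landed file): label set
`Theorems.isCompact_labelWindowGap`, `Theorems.stub_ikLocalStepU` (UN-6 ⇐ V-6 + UU-in + UN-2 + UN-6a),
`Theorems.stub_kerrBandHigherRegularityU`, `farSilent_band_subset_docOfU/…belowZoneU`,
`farSilent_chartPackageU`, the smooth level sweep, pushforward N-5 and the Hawking-pair bookkeeping.
[folklore composition; cite: IonescuKlainerman2013, Thm 1.2] -/
theorem outwardSweep_of_IK (hIK : IKLocalKillingExtension) : StubOutwardSweep :=
  Summit.FinalStateConjecture.FinalStateConjecture.Theorems.PhotonShellNode.outwardSweep_of_IK hIK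

/-- S5-at — rev c10's per-label theorem, now a corollary of `outwardSweep_of_IK`. [folklore] -/
theorem outwardSweepAt_of_IK (hIK : IKLocalKillingExtension) : StubOutwardSweepAt :=
  stubOutwardSweepAt_of_stubOutwardSweep (outwardSweep_of_IK hIK)

/-- **Stub 5 (S5) — THEOREM modulo the named fact `IKLocalKillingExtension`
(= `Literature…IonescuKlainermanLocalExtension`, Ionescu–Klainerman JAMS 26 (2013) Thm 1.2)**:
the outward Killing sweep from the uniform horizon collar `belowZone (r₊ + η₄)` to the inner face
`r_ph⁺ − ε` of the photon shell, with order `6` and ONE tolerance over the label window.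
[cite: IonescuKlainerman2013, Thm 1.2] -/
theorem stub_outwardSweep (hIK : IKLocalKillingExtension) : StubOutwardSweep :=
  outwardSweep_of_IK hIK

/-! ## §3c  The inward sweep from `IKLocalKillingExtension`: per label up to `R₀` (rev c10c), label-uniform = S3 (rev c11)

The mirror image of §3b for S3, with one more audit point: S3 lets the scri-side field `T` be
given on `farZone R` for a start radius `R` chosen WITH the spacetime (after `∃ k δ`), while a
fixed-band local step can only sweep a band `[c₀, c₁]` fixed before the spacetime (the
pseudo-convexity margin of the cylinder `{r = c}` and the admissible perturbation both decay
like `1/c`; exploiting the `r`-weighted closeness of `FarSilentNearKerr` to sweep from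
arbitrarily far out is a SCALE-COVARIANT argument not supplied by the landed bricks). Hence the
honest theorem is S3 at each label AND up to a label-level start radius `R₀`
(`StubInwardSweepAtUpTo`); `S3 ⇐ S3-at-upTo + (S2 with a label-level far radius, or the
scale-covariant far sweep)`. Bricks: the level sweep WITHOUT convexity
(`Theorems.stub_levelSweepDense`, p135741 — superlevel sets of `r` are not convex; glue on
half-radius balls), the outer radial cover (`Theorems.stub_kerrRadius_outerCover`, p135754),
the inward sweep instance (`Theorems.stub_kerrCoordKillingSweepSmoothOut`, p136136), the
outer-side normalised data / Killing transport / local step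
(`Theorems.stub_ikQuant6Out` p135898, `Theorems.stub_ikKillingBackOut` p135743,
`Theorems.stub_ikLocalStepOut` p136207 — IK fed `f̃ = s⁻²(c − r∘aff)`, U-out multiplier
`kerrMultiplierBeyondShellKS`), and §3b's chart package, pullback (G5) and pushforward (N-5). -/



/-- Statement of the PER-LABEL inward sweep UP TO a label-level start radius (S3-at-upTo): S3
with the label `(M, a)` and a bound `R₀` on the start radius quantified BEFORE `∃ k δ`. -/
def StubInwardSweepAtUpTo : Prop :=
  ∀ (χ κ₀ m₀ ε M a R₀ : ℝ), χ < 1 → 0 < κ₀ → 0 < m₀ → 0 < ε → m₀ ≤ M → M ≤ m₀⁻¹ → |a| ≤ χ * M →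
    ∃ (k : ℕ) (δ : ℝ), 0 < δ ∧
    ∀ (𝓢 : Spacetime.{0} 4) [𝓢.metric.HasLeviCivita]
      (Ψ : (starBG M a).domain → 𝓢.carrier) (t : 𝓢.carrier → ℝ),
      SilentEternalNearKerr 𝓢 M a Ψ k δ κ₀ t → PericentresBeyond M a (rPhMinus M a) →
      ∀ (R : ℝ) (T : Π x : 𝓢.carrier, TangentSpace (𝓡 4) x), R ≤ R₀ →
        TimelikeKillingBeyond 𝓢 M a Ψ T R →
      ∃ (T' : Π x : 𝓢.carrier, TangentSpace (𝓡 4) x) (R' : ℝ),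
        𝓢.metric.toPseudoRiemannianMetric.IsKillingFieldOn T' (farZone 𝓢 M a Ψ (rPhMinus M a + ε)) ∧
        TimelikeKillingBeyond 𝓢 M a Ψ T' R'

/-- S3 implies S3-at-upTo (move the label inside). [folklore] -/
theorem stubInwardSweepAtUpTo_of_stubInwardSweep (h : StubInwardSweep) : StubInwardSweepAtUpTo := by
  intro χ κ₀ m₀ ε M a R₀ hχ hκ₀ hm₀ hε hM hM' ha
  obtain ⟨k, δ, hδ, H⟩ := h χ κ₀ m₀ ε R₀ hχ hκ₀ hm₀ hε
  exact ⟨k, δ, hδ, fun 𝓢 _ Ψ t hS hP R T hR hT ↦ H 𝓢 M a Ψ t hM hM' ha hS hP R T hR hT⟩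

-- (rev c13) `rPlus_lt_rPhMinus` is the landed `Theorems.PhotonShellNode.rPlus_lt_rPhMinus` (p158619).

/-- **THE INWARD SWEEP S3 FROM IONESCU–KLAINERMAN (rev c11: label-UNIFORM, start radius bounded by
the label-level `R₀` of the reshaped S2; sorry-free modulo the named fact `IKLocalKillingExtension`).
rev c13: the proof is LANDED as `Theorems.PhotonShellNode.inwardSweep_of_IK` (`…InwardSweepOfIK.lean`,
p160200; statement = the body of `StubInwardSweep` verbatim).** Assembly: `Theorems.isCompact_labelWindow`,
`Theorems.stub_ikLocalStepOutU` (UN-6-out), `Theorems.stub_kerrBandHigherRegularityU`,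
`farSilent_chartPackageU`, `farSilent_band_subset_docOfU`, the smooth OUT level sweep, pushforward.
[folklore composition; cite: IonescuKlainerman2013, Thm 1.2] -/
theorem inwardSweep_of_IK (hIK : IKLocalKillingExtension) : StubInwardSweep :=
  Summit.FinalStateConjecture.FinalStateConjecture.Theorems.PhotonShellNode.inwardSweep_of_IK hIK

/-- S3-at-upTo — rev c10c's per-label theorem, now a corollary of `inwardSweep_of_IK`. [folklore] -/
theorem inwardSweepAtUpTo_of_IK (hIK : IKLocalKillingExtension) : StubInwardSweepAtUpTo :=
  stubInwardSweepAtUpTo_of_stubInwardSweep (inwardSweep_of_IK hIK)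

/-- **Stub 3 (S3) — THEOREM modulo the named fact `IKLocalKillingExtension`** (rev c11): the
inward Killing sweep from any far zone `{r > R}`, `R ≤ R₀`, down to the outer face `r_ph⁻ + ε`
of the photon shell, with order `6` and ONE tolerance over the label window.
[cite: IonescuKlainerman2013, Thm 1.2] -/
theorem stub_inwardSweep (hIK : IKLocalKillingExtension) : StubInwardSweep :=
  inwardSweep_of_IK hIK

/-- **Summary of rev c11: BOTH sweeps of the node, S3 and S5, with label-UNIFORM constants, are
theorems given Ionescu–Klainerman's local extension theorem.** [folklore] -/
theorem sweeps_of_IK (hIK : IKLocalKillingExtension) : StubOutwardSweep ∧ StubInwardSweep :=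
  ⟨outwardSweep_of_IK hIK, inwardSweep_of_IK hIK⟩

-- (rev c13) the node's one citable name `eternalSilentNearKerrIsKerr_of_IK` is at the end of the file (§3f).

/-! ## §3e  The `T`-conditional sweep S6b in Alexakis–Ionescu–Klainerman's stationary gauge (rev c12), FAR-COMPLETE (rev c13)

The kernel-closable content of S6b (`PLAN-S6b.md` of lead c11, steps 1/4/5/6). The `T`-adapted
chart of the plan (step 2′: flow the slice along `T`, so that `T = ∂₀` EXACTLY) is here a
HYPOTHESIS — the chart is STATIONARY: its metric components do not depend on `t*` beyond
`r₊ + ε/4` — which is precisely the gauge in which Alexakis–Ionescu–Klainerman (CMP 299 (2010),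
§1: a stationary spacetime with `T = ∂_t` in a global chart in which `g` is close to Kerr) extend
the Hawking field `K` across the whole exterior; and the commutation `[T, K] = 0` demanded by IK's
`T`-conditional extension theorem (Surveys 20 (2015) Thm 2.4) is the HYPOTHESIS that the chart
expression of `K` is `t*`-independent on the collar band. Producing that gauge and that commuting
Hawking field from S6's hypotheses stays with the OPEN belt node S6a (see `PLAN-S6b-far.md`). What IS
claimed: in that gauge the conditional sweep runs through EVERY cylinder `{r = c}`,
`r_ph⁺ − ε ≤ c ≤ R₁` — photon belt and ergoregion included — modulo the named fact
`IKConditionalLocalKillingExtension`, by the conditional twins of V-6/UN-6, W2-A′ and the §3d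
assembly, with the label-uniform `T`-conditional multiplier UU-T (p148954) as hypersurface input. -/

/-- **HYPOTHESIS-SHAPED RENDERING of Ionescu–Klainerman's `T`-CONDITIONAL local extension theorem
for Killing fields (Surveys Diff. Geom. 20 (2015), Thm 2.4 with Def. 2.2 and the quantitative form
Lemma 2.17; the Carleman weights of Invent. Math. 175 (2009), §3; carried out for the Hawking field
by Alexakis–Ionescu–Klainerman, CMP 299 (2010), §§5–6), chart form, `d = 4`, Lorentzian, in
coordinates ADAPTED to the conditioning Killing field: `T = τ` a CONSTANT vector.** The hypothesis
list of `IKLocalKillingExtension` (= `Literature…IonescuKlainermanLocalExtension`), plus: `τ : E4`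
with `A₁⁻¹ ≤ ‖τ‖ ≤ A₁` ("nowhere vanishing", quantified), `∂_τ G = 0` on the unit ball (`τ` is a
Killing field of `G`: for a constant field the coordinate Killing expression is `DG(τ)`),
`∂_τ f = 0` on the ball (the defining function is `T`-invariant, Def. 2.2), the quantitative
`T`-null-convexity of Lemma 2.17 at `p` — the multiplier form of (quant6) with the extra penalty
`A₁ (G_p(τ, X))²` — and data `Z` on `B_{δ₀}(p) ∩ {f < 0}` commuting with `τ` (`∂_τ Z = 0`, the
bracket with a constant field). Conclusion: a smooth solution `Z'` of the coordinate Killing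
equation on `B_{δ₁}(p)` agreeing with `Z` on `{f < 0}` and still commuting with `τ` ("Moreover the
extended `Z` continues to commute with `T`", loc. cit.), `δ₁` depending only on `A`, `A₁`, `δ₀`
(the uniformity printed for the unconditional theorem, JAMS 26 (2013), remark after Thm 1.2, whose
proof the conditional one follows "using similar techniques"). rev c12b: this is now the Literature NAMED FACT
`Literature.Geometry.Lorentzian.IonescuKlainermanConditionalLocalExtension`
(`Literature/Geometry/Lorentzian/KillingFieldLocalExtension.lean`, p153665; the SAME body is inlined here until
the farm has rebuilt that module, then `:= IonescuKlainermanConditionalLocalExtension`), kept under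
this name for the files that consume it by δ-unfolding (V-6T `ikLocalStepT_of_constants`, UN-6T
`stub_ikLocalStepTU`) and for `conditionalExtensionKStationary_of_IKC` below.
-- TODO(general form): a general nowhere-vanishing Killing `T` (flow-box coordinates reduce to this case); all dimensions and signatures.
[cite: IonescuKlainerman2015, Thm 2.4, Def. 2.2, Lemma 2.17] -/
def IKConditionalLocalKillingExtension : Prop :=
  IonescuKlainermanConditionalLocalExtension

/-- Statement of **S6b‴ (rev c12) — the `T`-conditional extension of the Hawking field in a
STATIONARY chart, up to a fixed radius `R₁`.** At a label of the window with the gap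
`r₊ + 2ε ≤ r_ph⁺`: if the star chart (any total `Φ` agreeing with `Ψ`) is STATIONARY beyond
`r₊ + ε/4` (`Φ^*g (z + s∂₀) = Φ^*g (z)`, so `T := Φ_* ∂₀` is Killing) and a Hawking Killing field
`K` on `V ∪ belowZone (r_ph⁺ − ε)` has a `t*`-independent chart expression on
`{r₊ + ε/4 < r < r_ph⁺ − ε}` (`[T, K] = 0`), then `K` extends to a Killing field on
`V' ∪ belowZone R₁`, `(K', V')` again a Hawking pair. The far completion `R₁ → ∞` and the passage from S6's hypotheses to this gauge are
NOT part of this statement (`PLAN-S6b-far.md`). -/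
def StubConditionalExtensionKStationary : Prop :=
  ∀ (χ κ₀ m₀ ε R₁ : ℝ), χ < 1 → 0 < κ₀ → 0 < m₀ → 0 < ε → ∃ (k : ℕ) (δ : ℝ), 0 < δ ∧
    ∀ (𝓢 : Spacetime.{0} 4) [𝓢.metric.HasLeviCivita] (M a : ℝ)
      (Ψ : (starBG M a).domain → 𝓢.carrier) (t : 𝓢.carrier → ℝ),
      m₀ ≤ M → M ≤ m₀⁻¹ → |a| ≤ χ * M →
      SilentEternalNearKerr 𝓢 M a Ψ k δ κ₀ t →
      Kerr.rPlus M a + 2 * ε ≤ rPhPlus M a →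
      ∀ (Φ : E4 → 𝓢.carrier), (∀ x : (starBG M a).domain, Φ x.1 = Ψ x) →
      (∀ z : E4, Kerr.rPlus M a + ε / 4 < Kerr.radius a z → ∀ s : ℝ,
        𝓢.metricInCoords Φ (z + s • E4.basisVector 0) = 𝓢.metricInCoords Φ z) →
      ∀ (K : Π x : 𝓢.carrier, TangentSpace (𝓡 4) x) (V : Set 𝓢.carrier),
        HawkingPair 𝓢 M a Ψ K V →
        𝓢.metric.toPseudoRiemannianMetric.IsKillingFieldOn K
          (V ∪ belowZone 𝓢 M a Ψ (rPhPlus M a - ε)) →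
        (∀ z : E4, Kerr.rPlus M a + ε / 4 < Kerr.radius a z → Kerr.radius a z < rPhPlus M a - ε →
          ∀ s : ℝ, (mfderiv 𝓘(ℝ, E4) (𝓡 4) Φ (z + s • E4.basisVector 0)).inverse
              (K (Φ (z + s • E4.basisVector 0))) =
            (mfderiv 𝓘(ℝ, E4) (𝓡 4) Φ z).inverse (K (Φ z))) →
      ∃ (K' : Π x : 𝓢.carrier, TangentSpace (𝓡 4) x) (V' : Set 𝓢.carrier),
        HawkingPair 𝓢 M a Ψ K' V' ∧
        𝓢.metric.toPseudoRiemannianMetric.IsKillingFieldOn K' (V' ∪ belowZone 𝓢 M a Ψ R₁)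

-- (rev c13) `coordField_glue` is the landed `Theorems.PhotonShellNode.coordField_glue` (…ConditionalExtensionFarTail.lean, p160359).

/-- Statement of **S6b‴-far (rev c13) — the `T`-conditional extension of the Hawking field in a
STATIONARY chart, to the WHOLE charted domain of outer communications, with ONE tolerance.** The
hypotheses of `StubConditionalExtensionKStationary` without the radius `R₁`; conclusion: the
extended Hawking field is Killing on `V' ∪ docOfChart` (`docOfChart = docOf ∩ range Ψ = ⋃_R belowZone R`),
`V' ⊆ V` a shrunk two-sided horizon neighbourhood.
This is the `K`-half of `GlobalKillingPair` in the stationary gauge; the passage from S6's hypotheses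
to this gauge (a stationary re-charting and a `∂₀`-commuting Hawking field) stays with the OPEN node S6a. -/
def StubConditionalExtensionKStationaryFar : Prop :=
  ∀ (χ κ₀ m₀ ε : ℝ), χ < 1 → 0 < κ₀ → 0 < m₀ → 0 < ε → ∃ (k : ℕ) (δ : ℝ), 0 < δ ∧
    ∀ (𝓢 : Spacetime.{0} 4) [𝓢.metric.HasLeviCivita] (M a : ℝ)
      (Ψ : (starBG M a).domain → 𝓢.carrier) (t : 𝓢.carrier → ℝ),
      m₀ ≤ M → M ≤ m₀⁻¹ → |a| ≤ χ * M →
      SilentEternalNearKerr 𝓢 M a Ψ k δ κ₀ t →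
      Kerr.rPlus M a + 2 * ε ≤ rPhPlus M a →
      ∀ (Φ : E4 → 𝓢.carrier), (∀ x : (starBG M a).domain, Φ x.1 = Ψ x) →
      (∀ z : E4, Kerr.rPlus M a + ε / 4 < Kerr.radius a z → ∀ s : ℝ,
        𝓢.metricInCoords Φ (z + s • E4.basisVector 0) = 𝓢.metricInCoords Φ z) →
      ∀ (K : Π x : 𝓢.carrier, TangentSpace (𝓡 4) x) (V : Set 𝓢.carrier),
        HawkingPair 𝓢 M a Ψ K V →
        𝓢.metric.toPseudoRiemannianMetric.IsKillingFieldOn K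
          (V ∪ belowZone 𝓢 M a Ψ (rPhPlus M a - ε)) →
        (∀ z : E4, Kerr.rPlus M a + ε / 4 < Kerr.radius a z → Kerr.radius a z < rPhPlus M a - ε →
          ∀ s : ℝ, (mfderiv 𝓘(ℝ, E4) (𝓡 4) Φ (z + s • E4.basisVector 0)).inverse
              (K (Φ (z + s • E4.basisVector 0))) =
            (mfderiv 𝓘(ℝ, E4) (𝓡 4) Φ z).inverse (K (Φ z))) →
      ∃ (K' : Π x : 𝓢.carrier, TangentSpace (𝓡 4) x) (V' : Set 𝓢.carrier),
        HawkingPair 𝓢 M a Ψ K' V' ∧ V' ⊆ V ∧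
        𝓢.metric.toPseudoRiemannianMetric.IsKillingFieldOn K' (V' ∪ docOfChart 𝓢 M a Ψ)

/-- **S6b‴-far FROM IONESCU–KLAINERMAN'S `T`-CONDITIONAL LOCAL EXTENSION (rev c13; sorry-free modulo
the hypothesis-shaped named fact `IKConditionalLocalKillingExtension`; the proof is LANDED as
`Theorems.PhotonShellNode.conditionalExtensionKStationaryFar_of_IKC`, `…ConditionalExtensionFar.lean`
p160695 + `…ConditionalExtensionFarTail.lean` p160359, statement = the body of
`StubConditionalExtensionKStationaryFar` verbatim).** In a stationary eternal near-Kerr star chart, a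
`∂_{t*}`-invariant Hawking Killing field on `V ∪ belowZone (r_ph⁺ − ε)` extends to a Killing field on
`V' ∪ docOfChart` — photon belt, ergoregion AND the whole far region — with ONE order (`6`) and ONE
tolerance over the label window. Near part (rev c12): the label-uniform conditional sweep
`Theorems.stub_kerrCoordKillingSweepSmoothT` fed by `Theorems.stub_ikLocalStepTU` through the
cylinders `{r = c}`, `r_ph⁺ − ε ≤ c ≤ c₁`, with `c₁ ≥ C M + 1`, keeping the `∂₀`-invariance of the
swept chart field. Far part (rev c13): the scale-free far chain `Theorems.farChartExtension` (p157128;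
universal `C ≥ 16`, `δfar > 0`) applied to the swept field on the collar `{C M / 2 < r < C M}` (its
weighted-closeness hypothesis is the chart package's, its stationarity hypothesis holds beyond
`C M / 4 > r₊ + ε/4`), the chart-level glue `coordField_glue` of the swept field (below `C M`) with the
far field (beyond `C M / 2`), pushforward N-5 of the glued field, and the Hawking-pair bookkeeping
with the near collar `U' = {M < r < r₊ + 3ε/4}` only (`Theorems.PhotonShellNode.hawkingPair_of_sweptFarChartFields`);
far chart points are in `docOf` because the far zone is open (F4). [cite: IonescuKlainerman2015, Thm 2.4] -/
theorem conditionalExtensionKStationaryFar_of_IKC (hIKC : IKConditionalLocalKillingExtension) :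
    StubConditionalExtensionKStationaryFar :=
  Summit.FinalStateConjecture.FinalStateConjecture.Theorems.PhotonShellNode.conditionalExtensionKStationaryFar_of_IKC
    hIKC

/-- **S6b‴ (rev c12) is the special case `belowZone R₁ ⊆ docOfChart` of S6b‴-far (rev c13)** —
THEOREM modulo the hypothesis-shaped named fact `IKConditionalLocalKillingExtension`
(IK Surveys Diff. Geom. 20 (2015) Thm 2.4, chart form). [cite: IonescuKlainerman2015, Thm 2.4] -/
theorem conditionalExtensionKStationary_of_IKC (hIKC : IKConditionalLocalKillingExtension) :
    StubConditionalExtensionKStationary := by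
  intro χ κ₀ m₀ ε R₁ hχ hκ₀ hm₀ hε
  obtain ⟨k, δ, hδ, H⟩ := conditionalExtensionKStationaryFar_of_IKC hIKC χ κ₀ m₀ ε hχ hκ₀ hm₀ hε
  refine ⟨k, δ, hδ, ?_⟩
  intro 𝓢 _ M a Ψ t hM hM' ha hS hgap Φ hΦΨ hstat K V hKV hKK hKinv
  obtain ⟨K', V', hHP, -, hKil⟩ := H 𝓢 M a Ψ t hM hM' ha hS hgap Φ hΦΨ hstat K V hKV hKK hKinv
  refine ⟨K', V', hHP, hKil.mono (union_subset_union_right _ ?_)⟩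
  rintro p ⟨⟨x, -, rfl⟩, hpdoc⟩
  exact ⟨hpdoc, x, rfl⟩

/-- **S6b‴ (rev c12) — THEOREM modulo the hypothesis-shaped named fact
`IKConditionalLocalKillingExtension`** (IK Surveys Diff. Geom. 20 (2015) Thm 2.4, chart form): the
`T`-conditional extension of a commuting Hawking Killing field in a stationary eternal near-Kerr
star chart, from `r_ph⁺ − ε` out to any fixed radius `R₁`, order `6`, ONE tolerance over the
label window. [cite: IonescuKlainerman2015, Thm 2.4] -/
theorem stub_conditionalExtensionKStationary (hIKC : IKConditionalLocalKillingExtension) :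
    StubConditionalExtensionKStationary :=
  conditionalExtensionKStationary_of_IKC hIKC

/-- **S6b‴-far (rev c13) — THEOREM modulo `IKConditionalLocalKillingExtension`**: the
`T`-conditional extension of a commuting Hawking Killing field in a stationary eternal near-Kerr
star chart to the WHOLE charted d.o.c. `∪ V'`, order `6`, ONE tolerance over the label window.
[cite: IonescuKlainerman2015, Thm 2.4] -/
theorem stub_conditionalExtensionKStationaryFar (hIKC : IKConditionalLocalKillingExtension) :
    StubConditionalExtensionKStationaryFar :=
  conditionalExtensionKStationaryFar_of_IKC hIKC

/-- Statement of **S6b‴-far-silent (rev c13c) — the far-complete conditional sweep with the SHARP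
hypothesis**: only the far/near silence clause `FarSilentNearKerr` of the bundle (no clock, no horizon
silence, no `κ₀`), everything else as in `StubConditionalExtensionKStationaryFar`. The sweeps never used
more (`hS.1` only), and the open gauge node S6a⁗ therefore only has to re-derive far/near silence in the
primed chart. Body verbatim the landed `Theorems.PhotonShellNode.conditionalExtensionKStationaryFarSilent_of_IKC`
(p162761) without its Ionescu–Klainerman hypothesis. -/
def StubConditionalExtensionKStationaryFarSilent : Prop :=
  ∀ (χ m₀ ε : ℝ), χ < 1 → 0 < m₀ → 0 < ε → ∃ (k : ℕ) (δ : ℝ), 0 < δ ∧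
    ∀ (𝓢 : Spacetime.{0} 4) [𝓢.metric.HasLeviCivita] (M a : ℝ)
      (Ψ : (starBG M a).domain → 𝓢.carrier),
      m₀ ≤ M → M ≤ m₀⁻¹ → |a| ≤ χ * M →
      FarSilentNearKerr 𝓢 M a Ψ k δ →
      Kerr.rPlus M a + 2 * ε ≤ rPhPlus M a →
      ∀ (Φ : E4 → 𝓢.carrier), (∀ x : (starBG M a).domain, Φ x.1 = Ψ x) →
      (∀ z : E4, Kerr.rPlus M a + ε / 4 < Kerr.radius a z → ∀ s : ℝ,
        𝓢.metricInCoords Φ (z + s • E4.basisVector 0) = 𝓢.metricInCoords Φ z) →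
      ∀ (K : Π x : 𝓢.carrier, TangentSpace (𝓡 4) x) (V : Set 𝓢.carrier),
        HawkingPair 𝓢 M a Ψ K V →
        𝓢.metric.toPseudoRiemannianMetric.IsKillingFieldOn K
          (V ∪ belowZone 𝓢 M a Ψ (rPhPlus M a - ε)) →
        (∀ z : E4, Kerr.rPlus M a + ε / 4 < Kerr.radius a z → Kerr.radius a z < rPhPlus M a - ε →
          ∀ s : ℝ, (mfderiv 𝓘(ℝ, E4) (𝓡 4) Φ (z + s • E4.basisVector 0)).inverse
              (K (Φ (z + s • E4.basisVector 0))) =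
            (mfderiv 𝓘(ℝ, E4) (𝓡 4) Φ z).inverse (K (Φ z))) →
      ∃ (K' : Π x : 𝓢.carrier, TangentSpace (𝓡 4) x) (V' : Set 𝓢.carrier),
        HawkingPair 𝓢 M a Ψ K' V' ∧ V' ⊆ V ∧
        𝓢.metric.toPseudoRiemannianMetric.IsKillingFieldOn K' (V' ∪ docOfChart 𝓢 M a Ψ)

/-- **S6b‴-far-silent — THEOREM modulo `IKConditionalLocalKillingExtension` (rev c13c; the landed
`Theorems.PhotonShellNode.conditionalExtensionKStationaryFarSilent_of_IKC`, p162761, δ-unfolded).**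
[cite: IonescuKlainerman2015, Thm 2.4] -/
theorem conditionalExtensionKStationaryFarSilent_of_IKC (hIKC : IKConditionalLocalKillingExtension) :
    StubConditionalExtensionKStationaryFarSilent :=
  Summit.FinalStateConjecture.FinalStateConjecture.Theorems.PhotonShellNode.conditionalExtensionKStationaryFarSilent_of_IKC
    hIKC

/-! ## §3f  The S6 re-split (rev c13): S6 ⇐ S6a‴ (stationary re-charting with a commuting Hawking
field — the OPEN belt node in gauge form) ∧ S6b‴-far (THEOREM modulo the named fact, §3e)

With the far completion in hand, everything the conditional sweep needs is isolated in ONE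
statement about the gauge: S6a‴ `StubStationaryRecharting`. Under S6's hypotheses (a Killing field
`T` beyond `r_ph⁻ + ε`, timelike far out; a Hawking Killing field on `V ∪ belowZone (r_ph⁺ − ε)`),
at any order/tolerance `(k', δ')` requested in advance, the star chart can be RE-CHOSEN on the same
region (`range Ψ' = range Ψ`, same `docOf`, same horizon) so that (i) `Ψ'` is again
`(k', δ')`-silent-near-Kerr of the same label, (ii) a total extension `Φ` of `Ψ'` is STATIONARY beyond
`r₊ + ε/4` (its metric components are `t*`-independent: `T = Φ_* ∂₀` there — the belt crossing for
`T`, the normalisation `T ≈ ∂_{t*}` from far-out timelikeness + weighted closeness, and the absence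
of secular drift of the `T`-orbits in an ETERNAL weighted-close chart are all inside this clause),
(iii) some field `T'` is Killing on `docOfChart ∪ V₁` and timelike far out, and (iv) a Hawking pair
`(K₁, V₁)` for `Ψ'`, Killing on `V₁ ∪ belowZone Ψ' (r_ph⁺ − ε)`, has a `t*`-independent chart
expression on the collar band (`[T, K₁] = 0`: `T`-invariant re-ignition of the Hawking field, AIK
GAFA 20 (2010) Thm 1.1-type). Honest status: OPEN (it contains rev c7's S6a `StubBeltBridgeT`);
everything else of S6 is kernel-checked modulo `IKConditionalLocalKillingExtension`. rev c13c: the live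
form of the open node is the CHART-LEVEL S6a⁗ `StubStationaryGauge` of §3g (no clock / horizon-silence
re-derivation); S6a‴ and `stub_beltBridge_of_far` below are kept as the rev-c13 record (sorry-free). -/

/-- Statement of S6a‴ (rev c13) — **STATIONARY RE-CHARTING WITH A COMMUTING HAWKING FIELD (the
OPEN belt node, gauge form; see the §3f header).** The order/tolerance `(k', δ')` of the re-charted
bundle is prescribed BEFORE `(k, δ)` (it is the pair the conditional sweep S6b‴-far asks for). -/
def StubStationaryRecharting : Prop :=
  ∀ (χ κ₀ m₀ ε : ℝ), χ < 1 → 0 < κ₀ → 0 < m₀ → 0 < ε → ∀ (k' : ℕ) (δ' : ℝ), 0 < δ' →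
    ∃ (k : ℕ) (δ : ℝ), 0 < δ ∧
    ∀ (𝓢 : Spacetime.{0} 4) [𝓢.metric.HasLeviCivita] (M a : ℝ)
      (Ψ : (starBG M a).domain → 𝓢.carrier) (t : 𝓢.carrier → ℝ),
      m₀ ≤ M → M ≤ m₀⁻¹ → |a| ≤ χ * M →
      SilentEternalNearKerr 𝓢 M a Ψ k δ κ₀ t →
      ∀ (T : Π x : 𝓢.carrier, TangentSpace (𝓡 4) x) (R : ℝ),
        𝓢.metric.toPseudoRiemannianMetric.IsKillingFieldOn T (farZone 𝓢 M a Ψ (rPhMinus M a + ε)) →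
        TimelikeKillingBeyond 𝓢 M a Ψ T R →
      ∀ (K : Π x : 𝓢.carrier, TangentSpace (𝓡 4) x) (V : Set 𝓢.carrier),
        HawkingPair 𝓢 M a Ψ K V →
        𝓢.metric.toPseudoRiemannianMetric.IsKillingFieldOn K
          (V ∪ belowZone 𝓢 M a Ψ (rPhPlus M a - ε)) →
      ∃ (Ψ' : (starBG M a).domain → 𝓢.carrier) (t' : 𝓢.carrier → ℝ) (Φ : E4 → 𝓢.carrier)
        (T' : Π x : 𝓢.carrier, TangentSpace (𝓡 4) x) (R' : ℝ)
        (K₁ : Π x : 𝓢.carrier, TangentSpace (𝓡 4) x) (V₁ : Set 𝓢.carrier),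
        range Ψ' = range Ψ ∧ docOf 𝓢 M a Ψ' = docOf 𝓢 M a Ψ ∧
        horizonOf 𝓢 M a Ψ' = horizonOf 𝓢 M a Ψ ∧
        SilentEternalNearKerr 𝓢 M a Ψ' k' δ' κ₀ t' ∧
        (∀ x : (starBG M a).domain, Φ x.1 = Ψ' x) ∧
        (∀ z : E4, Kerr.rPlus M a + ε / 4 < Kerr.radius a z → ∀ s : ℝ,
          𝓢.metricInCoords Φ (z + s • E4.basisVector 0) = 𝓢.metricInCoords Φ z) ∧
        𝓢.metric.toPseudoRiemannianMetric.IsKillingFieldOn T' (docOfChart 𝓢 M a Ψ ∪ V₁) ∧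
        TimelikeKillingBeyond 𝓢 M a Ψ T' R' ∧
        HawkingPair 𝓢 M a Ψ' K₁ V₁ ∧
        𝓢.metric.toPseudoRiemannianMetric.IsKillingFieldOn K₁
          (V₁ ∪ belowZone 𝓢 M a Ψ' (rPhPlus M a - ε)) ∧
        (∀ z : E4, Kerr.rPlus M a + ε / 4 < Kerr.radius a z → Kerr.radius a z < rPhPlus M a - ε →
          ∀ s : ℝ, (mfderiv 𝓘(ℝ, E4) (𝓡 4) Φ (z + s • E4.basisVector 0)).inverse
              (K₁ (Φ (z + s • E4.basisVector 0))) =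
            (mfderiv 𝓘(ℝ, E4) (𝓡 4) Φ z).inverse (K₁ (Φ z)))

/-- **S6 ⇐ S6a‴ ∧ S6b‴-far (rev c13, kernel-checked reduction).** Ask S6b‴-far for its pair
`(k₆, δ₆)` at `(χ, κ₀, m₀, ε)`, then S6a‴ for `(k, δ)` delivering a `(k₆, δ₆)`-silent stationary
re-charting; run the far-complete conditional sweep in the re-charted gauge and transfer the global
pair back through `range Ψ' = range Ψ`, `docOf Ψ' = docOf Ψ`, `horizonOf Ψ' = horizonOf Ψ`
(`HawkingPair` and `docOfChart` only see these sets; `V' ⊆ V₁` carries `T'`). [folklore] -/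
theorem stub_beltBridge_of_far (hA : StubStationaryRecharting)
    (hF : StubConditionalExtensionKStationaryFar) : StubBeltBridge := by
  intro χ κ₀ m₀ ε hχ hκ₀ hm₀ hε
  obtain ⟨k₆, δ₆, hδ₆, HF⟩ := hF χ κ₀ m₀ ε hχ hκ₀ hm₀ hε
  obtain ⟨k, δ, hδ, HA⟩ := hA χ κ₀ m₀ ε hχ hκ₀ hm₀ hε k₆ δ₆ hδ₆
  refine ⟨k, δ, hδ, ?_⟩
  intro 𝓢 _ M a Ψ t hM hM' ha hS hgap T R hTK hT K V hKV hKK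
  obtain ⟨Ψ', t', Φ, T', R', K₁, V₁, hrange, hdoc, hhor, hS', hΦΨ', hstat, hT'K, hT'R, hK₁V₁, hK₁K,
    hK₁inv⟩ := HA 𝓢 M a Ψ t hM hM' ha hS T R hTK hT K V hKV hKK
  obtain ⟨K', V', hHP', hV'V₁, hK'⟩ :=
    HF 𝓢 M a Ψ' t' hM hM' ha hS' hgap Φ hΦΨ' hstat K₁ V₁ hK₁V₁ hK₁K hK₁inv
  have hdocChart : docOfChart 𝓢 M a Ψ' = docOfChart 𝓢 M a Ψ := by
    unfold docOfChart; rw [hdoc, hrange]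
  refine ⟨T', K', V', R', ?_, ?_, hT'K.mono (union_subset_union_right _ hV'V₁), hT'R⟩
  · obtain ⟨hV'o, hhorV', hKilV', hnull⟩ := hHP'
    rw [hhor] at hhorV' hnull
    exact ⟨hV'o, hhorV', hKilV', hnull⟩
  · rw [union_comm, ← hdocChart]; exact hK'

/-! ## §3g  S6 at the CHART LEVEL (rev c13b; rev c13c slimmed): S6 ⇐ S6a⁗ `StubStationaryGauge` ∧
S6b‴-far-silent, by kernel-checked set bookkeeping

What a flow-straightening re-charting `Ψ' = Ψ ∘ σ` delivers are two chart-level facts — `σ` is ONTO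
the star domain and moves Kerr–Schild radii by at most `M/4` — from which the landed
`Theorems.PhotonShellNode.docOf_eq_chronologicalPast_of_sandwichU` (p161834: the d.o.c. seen by the
chart does not depend on the far zone defining it; `Ψ'({r > 3M})` is sandwiched between `Ψ({r > 13M/4})`
and `Ψ({r > 11M/4})`) gives `docOf Ψ' = docOf Ψ`, `range Ψ' = range Ψ`, `horizonOf Ψ' = horizonOf Ψ`,
so every horizon clause (`HawkingPair`) and `belowZone` transfer by rewriting, and the FarSilent form of
the far-complete conditional sweep runs in the primed gauge. S6a⁗ states the open node with exactly
these chart-level outputs; `stub_beltBridge_of_gauge` is the kernel-checked composition. -/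

/-- Statement of S6a⁗ (rev c13b/c13c) — **STATIONARY GAUGE, chart level (the OPEN belt node).** Under
S6's hypotheses and for `(k', δ')` prescribed first: a map `σ` of the star domain ONTO itself moving
Kerr–Schild radii by `≤ M/4` such that `Ψ ∘ σ` is `(k', δ')`-far/near-silent (`FarSilentNearKerr` only —
rev c13c: the clock and horizon-silence clauses of the bundle are NOT re-derived, since the conditional
sweep consumes only the far/near silence, `StubConditionalExtensionKStationaryFarSilent`), a total
extension `Φ` of `Ψ ∘ σ` STATIONARY beyond `r₊ + ε/4`, a field `T'` Killing on `docOfChart Ψ ∪ V₁`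
timelike far out, and a Hawking pair `(K₁, V₁)` for the ORIGINAL charted horizon, Killing on
`V₁ ∪ ((Ψ ∘ σ)({r < r_ph⁺ − ε}) ∩ docOf Ψ)`, with `t*`-independent `Φ`-chart expression on the
collar band (`[∂₀, K₁] = 0`). Content: belt crossing for `T` (rev c7's S6a), normalisation
`T ≈ c∂_{t*}` far out, no secular drift of the `T`-flow straightening in an ETERNAL weighted-close
chart, `T`-invariant re-ignition of the Hawking field. Size XL / open. -/
def StubStationaryGauge : Prop :=
  ∀ (χ κ₀ m₀ ε : ℝ), χ < 1 → 0 < κ₀ → 0 < m₀ → 0 < ε → ∀ (k' : ℕ) (δ' : ℝ), 0 < δ' →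
    ∃ (k : ℕ) (δ : ℝ), 0 < δ ∧
    ∀ (𝓢 : Spacetime.{0} 4) [𝓢.metric.HasLeviCivita] (M a : ℝ)
      (Ψ : (starBG M a).domain → 𝓢.carrier) (t : 𝓢.carrier → ℝ),
      m₀ ≤ M → M ≤ m₀⁻¹ → |a| ≤ χ * M →
      SilentEternalNearKerr 𝓢 M a Ψ k δ κ₀ t →
      ∀ (T : Π x : 𝓢.carrier, TangentSpace (𝓡 4) x) (R : ℝ),
        𝓢.metric.toPseudoRiemannianMetric.IsKillingFieldOn T (farZone 𝓢 M a Ψ (rPhMinus M a + ε)) →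
        TimelikeKillingBeyond 𝓢 M a Ψ T R →
      ∀ (K : Π x : 𝓢.carrier, TangentSpace (𝓡 4) x) (V : Set 𝓢.carrier),
        HawkingPair 𝓢 M a Ψ K V →
        𝓢.metric.toPseudoRiemannianMetric.IsKillingFieldOn K
          (V ∪ belowZone 𝓢 M a Ψ (rPhPlus M a - ε)) →
      ∃ (σ : (starBG M a).domain → (starBG M a).domain) (Φ : E4 → 𝓢.carrier)
        (T' : Π x : 𝓢.carrier, TangentSpace (𝓡 4) x) (R' : ℝ)
        (K₁ : Π x : 𝓢.carrier, TangentSpace (𝓡 4) x) (V₁ : Set 𝓢.carrier),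
        Function.Surjective σ ∧
        (∀ x : (starBG M a).domain, |Kerr.radius a (σ x).1 - Kerr.radius a x.1| ≤ M / 4) ∧
        FarSilentNearKerr 𝓢 M a (Ψ ∘ σ) k' δ' ∧
        (∀ x : (starBG M a).domain, Φ x.1 = (Ψ ∘ σ) x) ∧
        (∀ z : E4, Kerr.rPlus M a + ε / 4 < Kerr.radius a z → ∀ s : ℝ,
          𝓢.metricInCoords Φ (z + s • E4.basisVector 0) = 𝓢.metricInCoords Φ z) ∧
        𝓢.metric.toPseudoRiemannianMetric.IsKillingFieldOn T' (docOfChart 𝓢 M a Ψ ∪ V₁) ∧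
        TimelikeKillingBeyond 𝓢 M a Ψ T' R' ∧
        HawkingPair 𝓢 M a Ψ K₁ V₁ ∧
        𝓢.metric.toPseudoRiemannianMetric.IsKillingFieldOn K₁
          (V₁ ∪ ((Ψ ∘ σ) '' {x | Kerr.radius a x.1 < rPhPlus M a - ε} ∩ docOf 𝓢 M a Ψ)) ∧
        (∀ z : E4, Kerr.rPlus M a + ε / 4 < Kerr.radius a z → Kerr.radius a z < rPhPlus M a - ε →
          ∀ s : ℝ, (mfderiv 𝓘(ℝ, E4) (𝓡 4) Φ (z + s • E4.basisVector 0)).inverse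
              (K₁ (Φ (z + s • E4.basisVector 0))) =
            (mfderiv 𝓘(ℝ, E4) (𝓡 4) Φ z).inverse (K₁ (Φ z)))

/-- **Stub 6a⁗ (S6a⁗, rev c13b/c13c) — STATIONARY GAUGE at the chart level: the one OPEN node of the
line.** Size XL / open (see `StubStationaryGauge`). -/
theorem stub_stationaryGauge : StubStationaryGauge := by
  sorry

/-- **S6 ⇐ S6a⁗ ∧ S6b‴-far-silent (rev c13c, kernel-checked).** Ask the FarSilent form of the
far-complete conditional sweep for `(k₆, δ₆)` at `(χ, m₀, ε)`, then S6a⁗ for `(k, δ)` delivering a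
`(k₆, δ₆)`-far/near-silent stationary gauge; take order `max k 1` and tolerance `min δ δ₀` (`δ₀` the
label-uniform sandwich tolerance on the compact window `Theorems.isCompact_labelWindow`); transfer
`docOf`/`range`/`horizonOf`/`belowZone` to the primed chart by the sandwich, run the sweep there, and
read the global pair back (`HawkingPair` and `docOfChart` only see these sets; `V' ⊆ V₁` carries `T'`).
[folklore composition] -/
theorem stub_beltBridge_of_gauge (hG : StubStationaryGauge)
    (hF : StubConditionalExtensionKStationaryFarSilent) : StubBeltBridge := by
  intro χ κ₀ m₀ ε hχ hκ₀ hm₀ hε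
  obtain ⟨k₆, δ₆, hδ₆, HF⟩ := hF χ m₀ ε hχ hm₀ hε
  obtain ⟨Kℓ, hKℓ⟩ : ∃ Kℓ : Set (ℝ × ℝ),
      Kℓ = {ℓ : ℝ × ℝ | m₀ ≤ ℓ.1 ∧ ℓ.1 ≤ m₀⁻¹ ∧ |ℓ.2| ≤ χ * ℓ.1} := ⟨_, rfl⟩
  have hKc : IsCompact Kℓ := by rw [hKℓ]; exact Theorems.isCompact_labelWindow χ m₀ hm₀
  have hlab : ∀ ℓ ∈ Kℓ, 0 < ℓ.1 ∧ |ℓ.2| < ℓ.1 := by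
    intro ℓ hℓ
    rw [hKℓ] at hℓ
    obtain ⟨h1, -, h3⟩ := hℓ
    have hpos : 0 < ℓ.1 := hm₀.trans_le h1
    have h4 : χ * ℓ.1 < 1 * ℓ.1 := mul_lt_mul_of_pos_right hχ hpos
    exact ⟨hpos, by linarith⟩
  obtain ⟨δ₀, hδ₀, Hs⟩ :=
    Summit.FinalStateConjecture.FinalStateConjecture.Theorems.PhotonShellNode.docOf_eq_chronologicalPast_of_sandwichU
      Kℓ hKc hlab
  obtain ⟨k, δ, hδ, HG⟩ := hG χ κ₀ m₀ ε hχ hκ₀ hm₀ hε k₆ δ₆ hδ₆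
  refine ⟨max k 1, min δ δ₀, lt_min hδ hδ₀, ?_⟩
  intro 𝓢 _ M a Ψ t hM hM' ha hS hgap T R hTK hT K V hKV hKK
  have hMpos : 0 < M := hm₀.trans_le hM
  have hℓK : (M, a) ∈ Kℓ := by rw [hKℓ]; exact ⟨hM, hM', ha⟩
  have hSk : SilentEternalNearKerr 𝓢 M a Ψ k δ κ₀ t :=
    hS.mono (le_max_left _ _) (min_le_left _ _) hMpos.le
  obtain ⟨σ, Φ, T', R', K₁, V₁, hsurj, hrad, hFS', hΦΨ', hstat, hT'K, hT'R, hK₁V₁, hK₁K, hK₁inv⟩ :=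
    HG 𝓢 M a Ψ t hM hM' ha hSk T R hTK hT K V hKV hKK
  -- the sandwich `farZone Ψ (13M/4) ⊆ farZone (Ψ ∘ σ) (3M) ⊆ farZone Ψ (11M/4)`
  have hS₁ : farZone 𝓢 M a Ψ (13 * M / 4) ⊆ farZone 𝓢 M a (Ψ ∘ σ) (3 * M) := by
    rintro _ ⟨x, hx, rfl⟩
    obtain ⟨x', rfl⟩ := hsurj x
    have h := abs_le.1 (hrad x')
    refine ⟨x', ?_, rfl⟩
    show 3 * M < Kerr.radius a x'.1
    have hx' : 13 * M / 4 < Kerr.radius a (σ x').1 := hx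
    linarith [h.2]
  have hS₂ : farZone 𝓢 M a (Ψ ∘ σ) (3 * M) ⊆ farZone 𝓢 M a Ψ (11 * M / 4) := by
    rintro _ ⟨x', hx', rfl⟩
    have h := abs_le.1 (hrad x')
    refine ⟨σ x', ?_, rfl⟩
    show 11 * M / 4 < Kerr.radius a (σ x').1
    have hx'' : 3 * M < Kerr.radius a x'.1 := hx'
    linarith [h.1]
  have hdoc : docOf 𝓢 M a (Ψ ∘ σ) = docOf 𝓢 M a Ψ :=
    Hs (M, a) hℓK 𝓢 Ψ (max k 1) (min δ δ₀) (le_max_right _ _) (min_le_right _ _) hS.1 _ hS₁ hS₂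
  have hrange : range (Ψ ∘ σ) = range Ψ := hsurj.range_comp Ψ
  have hhor : horizonOf 𝓢 M a (Ψ ∘ σ) = horizonOf 𝓢 M a Ψ := by
    unfold horizonOf; rw [hdoc, hrange]
  have hdocChart : docOfChart 𝓢 M a (Ψ ∘ σ) = docOfChart 𝓢 M a Ψ := by
    unfold docOfChart; rw [hdoc, hrange]
  have hbz : belowZone 𝓢 M a (Ψ ∘ σ) (rPhPlus M a - ε) =
      (Ψ ∘ σ) '' {x | Kerr.radius a x.1 < rPhPlus M a - ε} ∩ docOf 𝓢 M a Ψ := by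
    unfold belowZone; rw [hdoc]
  have hHP₁ : HawkingPair 𝓢 M a (Ψ ∘ σ) K₁ V₁ := by
    unfold HawkingPair; rw [hhor]; exact hK₁V₁
  have hK₁K' : 𝓢.metric.toPseudoRiemannianMetric.IsKillingFieldOn K₁
      (V₁ ∪ belowZone 𝓢 M a (Ψ ∘ σ) (rPhPlus M a - ε)) := by
    rw [hbz]; exact hK₁K
  -- the far-complete conditional sweep in the primed (stationary) gauge
  obtain ⟨K', V', hHP', hV'V₁, hK'⟩ :=
    HF 𝓢 M a (Ψ ∘ σ) hM hM' ha hFS' hgap Φ hΦΨ' hstat K₁ V₁ hHP₁ hK₁K' hK₁inv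
  refine ⟨T', K', V', R', ?_, ?_, hT'K.mono (union_subset_union_right _ hV'V₁), hT'R⟩
  · unfold HawkingPair at hHP' ⊢
    rw [hhor] at hHP'
    exact hHP'
  · rw [union_comm, ← hdocChart]; exact hK'

/-- **Stub 6 (S6) — THE BELT BRIDGE is a THEOREM modulo S6a⁗ (OPEN, chart level) and the named
fact `IKConditionalLocalKillingExtension` (rev c13c).** [folklore composition; cite: IonescuKlainerman2015, Thm 2.4] -/
theorem stub_beltBridge (hIKC : IKConditionalLocalKillingExtension) : StubBeltBridge :=
  stub_beltBridge_of_gauge stub_stationaryGauge (conditionalExtensionKStationaryFarSilent_of_IKC hIKC)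

/-- **The node from S1 (proved), S3/S5 (theorems modulo `IKLocalKillingExtension`, rev c11), S6
(theorem modulo S6a‴ and `IKConditionalLocalKillingExtension`, rev c13) and the sorried analytic
stubs S2, S4, S6a⁗, S7 — one citable name.** [folklore] -/
theorem eternalSilentNearKerrIsKerr_of_IK (hIK : IKLocalKillingExtension)
    (hIKC : IKConditionalLocalKillingExtension) : EternalSilentNearKerrIsKerr :=
  EternalSilentNearKerrIsKerr_of stub_kerrShellTurning stub_scriIgnition (stub_inwardSweep hIK)
    stub_horizonIgnition (stub_outwardSweep hIK) (stub_beltBridge hIKC) stub_perturbativeRigidity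

/-- **THE NODE MODULO EXACTLY ITS OPEN CONTENT (rev c13c): scri ignition S2, horizon ignition S4,
the chart-level stationary gauge S6a⁗ and perturbative rigidity S7 — given Ionescu–Klainerman's two
local extension theorems — imply `EternalSilentNearKerrIsKerr`.** Sorry-free. [folklore] -/
theorem eternalSilentNearKerrIsKerr_of_open (hIK : IKLocalKillingExtension)
    (hIKC : IKConditionalLocalKillingExtension) (h₂ : StubScriIgnition) (h₄ : StubHorizonIgnition)
    (h₆ : StubStationaryGauge) (h₇ : StubPerturbativeRigidity) : EternalSilentNearKerrIsKerr :=
  EternalSilentNearKerrIsKerr_of stub_kerrShellTurning h₂ (stub_inwardSweep hIK) h₄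
    (stub_outwardSweep hIK)
    (stub_beltBridge_of_gauge h₆ (conditionalExtensionKStationaryFarSilent_of_IKC hIKC)) h₇

end Summit.FinalStateConjecture.FinalStateConjecture.Cruxes.GapExhaustion.PhotonShellPseudoconvexity

end
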